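import Mathlib
import HarnessLib
import Literature.Analysis.FluidPDE.VorticityCalculus
import Summits.NavierStokesRegularity.NavierStokesRegularity.Theses.PoloidalWindowDoor
import Summits.NavierStokesRegularity.NavierStokesRegularity.Theses.LoopPeriodRatchet
import Summits.NavierStokesRegularity.NavierStokesRegularity.Theorems.PoloidalWindowDoorPoloidalWindowRigidityWindow
import Summits.NavierStokesRegularity.NavierStokesRegularity.Theorems.SymmetryModuliCountSymmetricLiouville
import Summits.NavierStokesRegularity.NavierStokesRegularity.Theorems.PoloidalWindowDoorPoloidalWindowRigidityHotLoopsReduction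
import Summits.NavierStokesRegularity.NavierStokesRegularity.Theorems.PoloidalWindowDoorPoloidalWindowRigidityHotHullCompactness
import Summits.NavierStokesRegularity.NavierStokesRegularity.Theorems.PoloidalWindowDoorPoloidalWindowRigidityPoloidalExtremal
import Summits.NavierStokesRegularity.NavierStokesRegularity.Theorems.PoloidalWindowDoorPoloidalWindowRigidityPoloidalExtremalSelfRecurrent
import Summits.NavierStokesRegularity.NavierStokesRegularity.Theorems.PoloidalWindowDoorPoloidalWindowRigiditySymmetryGerms
import Summits.NavierStokesRegularity.NavierStokesRegularity.Theorems.PoloidalWindowDoorPoloidalWindowRigidityVerticalShearGerm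
import Summits.NavierStokesRegularity.NavierStokesRegularity.Theorems.PoloidalWindowDoorLrcModEntireFarThreadReduction
import Summits.NavierStokesRegularity.NavierStokesRegularity.Theorems.PoloidalWindowDoorLrcModEntireThreadDichotomy
import Summits.NavierStokesRegularity.NavierStokesRegularity.Theorems.PoloidalWindowDoorLrcModEntireThreadPins
import Summits.NavierStokesRegularity.NavierStokesRegularity.Theorems.PoloidalWindowDoorLrcModEntireIff
import Summits.NavierStokesRegularity.NavierStokesRegularity.Theorems.PoloidalWindowDoorLrcModEntireUntwistedGerm
import Summits.NavierStokesRegularity.NavierStokesRegularity.Theorems.PoloidalWindowDoorLrcModEntireTwistingTHLocalHypGerm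
import Summits.NavierStokesRegularity.NavierStokesRegularity.Theorems.PoloidalWindowDoorLrcModEntireTwistingTHLocalNonUmbilic
import Summits.NavierStokesRegularity.NavierStokesRegularity.Theorems.PoloidalWindowDoorLrcModEntireTwistingTHLocalGalilean
import Summits.NavierStokesRegularity.NavierStokesRegularity.Theorems.PoloidalWindowDoorLrcModEntireTwistingTHLocalNormalFormRS
import Summits.NavierStokesRegularity.NavierStokesRegularity.Theorems.SymmetricLiouville.Negative.SmallConstantGap
import Summits.NavierStokesRegularity.NavierStokesRegularity.Theorems.SymmetricLiouville.Negative.NonlinearLoadBearing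
import Summits.NavierStokesRegularity.NavierStokesRegularity.Theorems.PoloidalWindowDoorPoloidalWindowRigidityLeastPinAnisotropicGap
import Summits.NavierStokesRegularity.NavierStokesRegularity.Theorems.PoloidalWindowDoorPoloidalWindowRigidityLeastPinNoPinLoss
import Summits.NavierStokesRegularity.NavierStokesRegularity.Theorems.PoloidalWindowDoorPoloidalWindowRigidityEternalCoreParaboloidGap
import Summits.NavierStokesRegularity.NavierStokesRegularity.Theorems.PoloidalWindowDoorPoloidalWindowRigidityEternalCoreScalingCore
import Literature.Analysis.FluidPDE.TypeIAncientMildRescale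
import Literature.Analysis.FluidPDE.NSBoundedMildSmoothing

/-!
# Crux `PoloidalWindowRigidity` (K2, stmt-NavierStokesRegularity-19708) + item `LrcModEntire` (stmt-20428) — LINE 25 `eternal_pin` (v1.0)
# (IDEATOR seat ns-idea-8, generation 11; lens «barrier» (the TIME-SHIFT semigroup: the one class-preserving map that CONTRACTS the scale-invariant speed);
#  bears_on LADDER-NS N0, rung N0-LocalTubeDoorPoloidal, THICK column; targets the UNIVERSAL residue HL3′ of the column through LINE 24's cell LEAST-PIN,
#  VERBATIM.)

**No summit and no crux is proved here.**  `PoloidalWindowRigidity_of_eternalPin` / `LrcModEntire_of_eternalPin` are CONDITIONAL on the one sorried research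
cell and on the two shared column hypotheses S0 and ⟨27893⟩ (explicit binders `hS0`, `hG` — the (TH) column's `stub_localTHEmptyHypNUGRS` and the wall
`LoopPeriodRatchet.FrequencyGrowthExponent`), like every line of the column.  §0–§10 are LINE 24 `least_pin` v1.1 VERBATIM (both hands LANDED: U3a p709185,
U3b p709332; every def identical), re-namespaced; the NEW content is §11–§14: the TIME-SHIFT LEMMA (`isTypeIAncientMild_timeShift`, PROVED), the PAST-PIN LAW
(`pastPin`, PROVED from U3b), the ETERNAL-PIN-IN-SCALE-WINDOWS theorem (`scaleWindowPin_of_noPinLoss`, PROVED from U3b + U2b's eternal core + K2-p2 g14's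
`…EternalCoreScalingCore.eternalCore_of_limit`), its blow-down forms `nearPinnedBlowDowns` / `nearPinnedBlowDownLimit` (PROVED: census B-g8-3 inverted up to `η` — near-pinned ADMISSIBLE blow-down limits exist
for every `η`), and one research cell ETERNAL-PIN with its kernel.  NO HAND STUB IS NEEDED: everything provable is proved
in-file; sorries = 1 (the research cell).

## Thesis (one sentence)

The admissible class of LINE 24 (class `C`, e₂-poloidal, peakless, dominated by the least pin `|N|`, `≢ 0`) is invariant under FORWARD TIME SHIFTS
`V ↦ V(· + s₁)` (`s₁ < 0`: restart the ancient solution earlier and stop it at time `s₁` before its end), and a time shift CONTRACTS the scale-invariant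
vertical speed by the factor `√(−t)/√(−t−s₁) < 1`, which tends to `1` only as `t → −∞`; so LINE 24's NO-PIN-LOSS (the sup `|N|` is realised by EVERY admissible
profile), applied to the time shifts, forces every admissible profile — in particular the least-pin profile itself and each of its non-zero blow-downs — to be
NEAR-EXTREMAL IN THE ARBITRARILY FAR PAST (`limsup_{s→−∞} sup_x √(−s)|V₂(s,x)| = |N|`, PAST PIN), and then compactness + the eternal core make the pin ETERNAL IN
SCALE: for every `η > 0` there is `Λ(η)` such that EVERY backward scale window `[Λt₀, t₀]`, `t₀ ≤ −1`, contains a point `‖x‖ ≤ Λ√(−t)` with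
`√(−t)|v₂(t,x)| > |N| − η` (critic idea-crit-7 g8's W1 «eternal pin», made a theorem in the sup sense, with a bounded aperture).

## Why this line (lens «barrier»: the symmetry SEMIGROUP of the class, not its symmetry group)

Every line of the column so far used the symmetry GROUP of the Type-I ancient class (scalings about the blow-up point, spatial translations, rotations about
the poloidal axis): each acts ISOMETRICALLY on the scale-invariant speed `√(−t)|v|`, which is why extremal / least-pin / recurrence arguments never gained an
inequality from them.  The class has ONE more closure property, a semigroup: FORWARD TIME SHIFTS (`timeShift_class` exists in the tree for the half-space
door, `…CriticalStretchingAnalytic.timeShift_class`, used there for a far-past-suffices remark; `IsTypeIAncientMild` form proved here).  A time shift keeps the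
Type-I constant (`√(−t) ≤ √(−t−s₁)`) and keeps domination by `|N|`, but multiplies the scale-invariant speed at shifted time `t` by `√(−t)/√(−t−s₁) < 1`.
Feeding the shifted profile to U3b (`NoPinLoss`, LANDED p709332) yields near-extremal points of the ORIGINAL profile at times `−(t+s₁) > |N|(−s₁)/(2η′)` — as
far in the past as we please (`pastPin`, 60 lines of real arithmetic).  Consequences, all PROVED:

* **PAST PIN for every admissible `V`** (`pastPin`): `∀ η > 0, ∀ T < 0, ∃ s < T, ∃ x, √(−s)|V₂(s,x)| > |N| − η`.  The pin time `−1` is not special: a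
  least-pin profile is near-extremal at a sequence of times `s_k → −∞`.
* **ETERNAL PIN IN SCALE WINDOWS** (`scaleWindowPin_of_noPinLoss`): if windows `[Λₙtₙ, tₙ] × {‖x‖ ≤ Λₙ√(−t)}` with `Λₙ → ∞` were `η`-pin-free, rescale
  `tₙ ↦ −1` (`nsRescale √(−tₙ)`; class / poloidal / peakless / dominated are scale-invariant: `IsTypeIAncientMild.nsRescale`, `poloidal_nsRescale`,
  `peakless_nsRescale` (p709332), `extremal_nsRescale` (p709077 `…EternalCoreScalingCore`, K2-p2 g14)); a KNSS limit `V` (`exists_tendsto_of_isTypeIAncientMild_seq`)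
  is admissible — NON-ZERO because the eternal core of the pinned profile (U2 `eternalCore_of_pinned` ⇐ U2b `paraboloidGap`, LANDED p707892) is scale-covariant
  (`eternalCore_nsRescale`) and passes to slice-wise limits inside the class (`eternalCore_of_limit`, K2-p2 g14, LANDED) — and `η`-pin-free on the whole
  half-space `{t ≤ −1}`; PAST PIN for `V` with `T = −1` is the contradiction.
* Hence the cell: a least-pin profile is pinned, thick, peakless, least-pin, obeys no-pin-loss, PAST PIN (as a law over its admissible class) and is
  ETERNALLY PINNED IN SCALE with bounded aperture `Λ(η)`.  What this buys the blow-down programme (LINE 23 U2d, hot_hull RECURRENT-LEAF): for fixed `η` the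
  blow-downs `√(−t)·v(−t·, √(−t)·)` along the window times carry an `η`-near-pin INSIDE the ball `‖x‖ ≤ Λ(η)` at time `−1` — census B-g8-3 («blow-downs at
  the pin lose the pin») is FALSE up to `η` and a bounded translation, for least-pin profiles.  Honest limit: the aperture `Λ(η)` may blow up as `η → 0`, so an
  EXACTLY pinned blow-down is not claimed.

## What is proved / what is open

PROVED (no sorry): everything of LINE 24 v1.1 (hands landed) + `isTypeIAncientMild_timeShift`, `pastPin`, `pastPin_self`, `scaleWindowPin_of_noPinLoss`,
`nearPinnedBlowDowns`, `nearPinnedBlowDownLimit`, `cellLeastPin_of_eternalPin` (kernel: the two new binders of the cell are theorems), `hl3_of_eternalPin`, `PoloidalWindowRigidity_of_eternalPin`,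
`LrcModEntire_of_eternalPin`.  OPEN (sorry 1): `stub_cellEternalPin` — research cell ETERNAL-PIN = cell LEAST-PIN + `PastPin C v` + `ScaleWindowPin v`.
Hands: NONE needed (0 provable stubs left open).  Killing quantity still missing (honest): a rigidity theorem turning «near-extremal in every scale window with
bounded aperture» into self-similarity or into a contradiction with `Peakless`/thickness; nothing of the kind is claimed.

## Novelty / prior art (search-before-claim)

Nearest in the tree: `…HalfSpaceWindowDoorCirculationCarryingRigidityCriticalStretchingAnalytic.timeShift_class` (four-clause class is time-shift invariant;
used to globalise a far-past hypothesis — a different door, no extremal functional); `…UnthreadedDoorShiftedPoloidalClass` (time shifts land in the bounded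
class); LINE 24 U3b itself.  No line of the THICK column (hot_split … least_pin, K2-p3's (TH) programme) uses the contraction `√(−t)/√(−t−s₁)`; the column's
censuses list time translation only as a symmetry «→ nothing» (ns-idea-8 g9).  Literature: the move «an extremal ancient solution must realise its extremal
value at `t = −∞` because forward restarts are again admissible and strictly smaller in the critical normalisation» — presearch: corpus `lit search --hybrid`
"ancient solution Navier-Stokes time translation Type I bound supremum attained infinite past" → generic hits only (Majda–Bertozzi p.103, Seregin 2014 notes
p.109, Robinson–Rodrigo–Sadowski p.199: no statement of this shape); `lit vsearch` (prose of PAST PIN) → none relevant (Barenblatt 1979 p.103 on intermediate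
asymptotics is the closest in spirit); galaxy `"ancient solution|time shift|Type I ancient" --star pdf` → 0 relevant /8.  Delta in one sentence: the
semigroup direction of the symmetry class converts LINE 24's qualitative minimality into a LOCATED statement (far past, every scale, bounded aperture).

## Barriers

- technique_class: critical-element / compactness–rigidity + a one-parameter MONOTONE deformation inside the class (time-shift semigroup); NOT point-local,
  NOT averaged, NOT a comparison principle, NOT leaf-local, NOT planar-topological, NOT a frequency functional.
- B-g8-3 (blow-downs at the pin lose the window and the pin): MET HEAD-ON and inverted up to `η` (see above); the line never needs an exactly pinned limit.
- B-g10-2 (secondary extremalisation without a gap): not this line — no new functional is extremalised; the gap U3a and the least pin are LINE 24's, landed.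
- `GaussianMonotonicityVertexDivergence` / monotonicity-formula barriers: not in play — the monotone quantity here is the trivial factor `√(−t)/√(−t−s₁)` along an
  exact symmetry semigroup, not a weighted energy.
- Wall ⟨27893⟩ / S0: untouched, entering only through the landed reduction and `THGerm`, as in every line of the column.
- Negatives index (`ledger negatives --problem NavierStokesRegularity`): no refuted statement concerns pin values, time shifts or scale-window recurrence; the
  dead GLOBAL class `stub_smallAtMinusInfinityLiouville` (smallness at −∞ everywhere) is the opposite regime (we prove LARGENESS at −∞ along a sequence).

## Hands and cells (sorries = 1)

* `stub_cellEternalPin` — research cell ETERNAL-PIN (OPEN): LEAST-PIN's binders + `PastPin C v` + `ScaleWindowPin v`.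
* PROVED: all of LINE 24 v1.1 + §11–§14 as listed.  LABELS: files-only line of a door route; no cell / crux / route item closed; 19708 / 20428 OPEN; NS
  regularity NOT proved.
-/

noncomputable section

set_option linter.dupNamespace false
set_option linter.unusedVariables false
set_option linter.unusedSectionVars false

namespace Summit.NavierStokesRegularity.NavierStokesRegularity.Cruxes.PoloidalWindowRigidity.EternalPin

open Set Function MeasureTheory Filter Topology Metric
open scoped InnerProductSpace RealInnerProductSpace Laplacian
open Literature.Analysis Literature.Analysis.FluidPDE
open Summit.NavierStokesRegularity.NavierStokesRegularity.Theses.PoloidalWindowDoor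
open Summit.NavierStokesRegularity.NavierStokesRegularity.Theorems

/-! ## §0 The column's objects, VERBATIM (hot_split v1.6 = hot_forest = hot_hull = uniform_return = eternal_core) -/

/-- **Pinned** — VERBATIM hot_split: Type-I decay, continuity, mild identity, div-free, e₃-poloidal, `N := v₂(−1,0) ≠ 0`, the global bound
`√(−t)|v₂| ≤ |N|`, `∇v₂(−1,0) = 0`, the time and Laplace pins. -/
def Pinned (C : ℝ) (v : ℝ → EuclideanSpace ℝ (Fin 3) → EuclideanSpace ℝ (Fin 3)) : Prop :=
  Literature.Analysis.FluidPDE.HasTypeITimeDecay C v ∧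
  ContinuousOn (Function.uncurry v) (Set.Iio (0 : ℝ) ×ˢ Set.univ) ∧
  (∀ s t : ℝ, s < t → t < 0 → ∀ x, v t x =
    Literature.Analysis.UnboundedOperators.heatExtension (v s) (t - s) x -
      Literature.Analysis.FluidPDE.oseenDuhamel 1 s v v t x) ∧
  (∀ t < 0, Literature.Analysis.FluidPDE.VectorCalculus.IsDivFree (v t)) ∧
  (∀ s < 0, ∀ y, ⟪Literature.Analysis.FluidPDE.curl (v s) y, EuclideanSpace.single 2 1⟫_ℝ = 0) ∧
  v (-1) 0 2 ≠ 0 ∧ (∀ t < 0, ∀ x, Real.sqrt (-t) * |v t x 2| ≤ |v (-1) 0 2|) ∧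
  (∀ h : EuclideanSpace ℝ (Fin 3), fderiv ℝ (v (-1)) 0 h 2 = 0) ∧
  (deriv (fun s => v s 0 2) (-1) = v (-1) 0 2 / 2 ∧ v (-1) 0 2 * (Δ (fun y => v (-1) y 2)) 0 ≤ 0)

/-- **ThickWindow** — VERBATIM hot_split. -/
def ThickWindow (v : ℝ → EuclideanSpace ℝ (Fin 3) → EuclideanSpace ℝ (Fin 3)) (W : Set (ℝ × EuclideanSpace ℝ (Fin 3))) : Prop :=
  IsOpen W ∧ W ⊆ Set.Iio (0 : ℝ) ×ˢ Set.univ ∧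
  (∀ z ∈ W, (Literature.Analysis.FluidPDE.curl (v z.1) z.2 ≠ 0 ∧
      (fderiv ℝ (v z.1) z.2 (EuclideanSpace.single 0 1) 2 ≠ 0 ∨ fderiv ℝ (v z.1) z.2 (EuclideanSpace.single 1 1) 2 ≠ 0) ∧
      (fderiv ℝ (v z.1) z.2 (EuclideanSpace.single 2 1) 0 ≠ 0 ∨ fderiv ℝ (v z.1) z.2 (EuclideanSpace.single 2 1) 1 ≠ 0)) ∧
    (fderiv ℝ (fun x => fderiv ℝ (v z.1) x (EuclideanSpace.single 2 1) 2) z.2 (EuclideanSpace.single 0 1) *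
          fderiv ℝ (v z.1) z.2 (EuclideanSpace.single 1 1) 2 -
        fderiv ℝ (fun x => fderiv ℝ (v z.1) x (EuclideanSpace.single 2 1) 2) z.2 (EuclideanSpace.single 1 1) *
          fderiv ℝ (v z.1) z.2 (EuclideanSpace.single 0 1) 2 ≠ 0)) ∧
  (∀ m : ℝ → ℝ → ℝ, ∀ W₁ : Set (ℝ × EuclideanSpace ℝ (Fin 3)), W₁ ⊆ W → IsOpen W₁ → W₁.Nonempty →
      ∃ z ∈ W₁, ∃ b : Fin 3, b ≠ 2 ∧
        fderiv ℝ (v z.1) z.2 (EuclideanSpace.single 2 1) b ≠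
          m z.1 (z.2 2) * fderiv ℝ (v z.1) z.2 (EuclideanSpace.single b 1) 2) ∧
  (∀ r : ℝ, 0 < r → (Metric.ball ((-1 : ℝ), (0 : EuclideanSpace ℝ (Fin 3))) r ∩ W).Nonempty)

/-- **Peakless** — VERBATIM hot_split: no island bracket of `σ·v₂(s,·)` on any horizontal plane at any time `s < 0`. -/
def Peakless (v : ℝ → EuclideanSpace ℝ (Fin 3) → EuclideanSpace ℝ (Fin 3)) : Prop :=
  ∀ (s z₀ σ M : ℝ) (K O : Set (EuclideanSpace ℝ (Fin 3))), s < 0 →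
    ((σ = 1 ∨ σ = -1) ∧ IsCompact K ∧ K.Nonempty ∧ (∀ y ∈ K, y 2 = z₀ ∧ σ * v s y 2 = M) ∧
      IsOpen O ∧ K ⊆ O ∧ (∀ y ∈ O, y 2 = z₀ → σ * v s y 2 ≤ M) ∧
      (∀ y ∈ O, y 2 = z₀ → σ * v s y 2 = M → y ∈ K)) → False

/-- The HOT SET of the hot-spot plane `P₀ = {y₂ = 0}` at time `−1` — VERBATIM hot_split: `H := {y : y₂ = 0, v₂(−1,y) = v₂(−1,0)}`. -/
def hotSet (v : ℝ → EuclideanSpace ℝ (Fin 3) → EuclideanSpace ℝ (Fin 3)) : Set (EuclideanSpace ℝ (Fin 3)) :=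
  {y | y 2 = 0 ∧ v (-1) y 2 = v (-1) 0 2}

/-- `ThickWindow` re-centred at an arbitrary space-time point `z₀` (the body of `ThickWindow`, VERBATIM, with `Metric.ball z₀ r`);
`ThickWindowAt v W (−1, 0)` is `ThickWindow v W` definitionally. -/
def ThickWindowAt (v : ℝ → EuclideanSpace ℝ (Fin 3) → EuclideanSpace ℝ (Fin 3)) (W : Set (ℝ × EuclideanSpace ℝ (Fin 3)))
    (z₀ : ℝ × EuclideanSpace ℝ (Fin 3)) : Prop :=
  IsOpen W ∧ W ⊆ Set.Iio (0 : ℝ) ×ˢ Set.univ ∧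
    (∀ z ∈ W, (Literature.Analysis.FluidPDE.curl (v z.1) z.2 ≠ 0 ∧
        (fderiv ℝ (v z.1) z.2 (EuclideanSpace.single 0 1) 2 ≠ 0 ∨ fderiv ℝ (v z.1) z.2 (EuclideanSpace.single 1 1) 2 ≠ 0) ∧
        (fderiv ℝ (v z.1) z.2 (EuclideanSpace.single 2 1) 0 ≠ 0 ∨ fderiv ℝ (v z.1) z.2 (EuclideanSpace.single 2 1) 1 ≠ 0)) ∧
      (fderiv ℝ (fun x => fderiv ℝ (v z.1) x (EuclideanSpace.single 2 1) 2) z.2 (EuclideanSpace.single 0 1) *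
            fderiv ℝ (v z.1) z.2 (EuclideanSpace.single 1 1) 2 -
          fderiv ℝ (fun x => fderiv ℝ (v z.1) x (EuclideanSpace.single 2 1) 2) z.2 (EuclideanSpace.single 1 1) *
            fderiv ℝ (v z.1) z.2 (EuclideanSpace.single 0 1) 2 ≠ 0)) ∧
    (∀ m : ℝ → ℝ → ℝ, ∀ W₁ : Set (ℝ × EuclideanSpace ℝ (Fin 3)), W₁ ⊆ W → IsOpen W₁ → W₁.Nonempty →
        ∃ z ∈ W₁, ∃ b : Fin 3, b ≠ 2 ∧
          fderiv ℝ (v z.1) z.2 (EuclideanSpace.single 2 1) b ≠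
            m z.1 (z.2 2) * fderiv ℝ (v z.1) z.2 (EuclideanSpace.single b 1) 2) ∧
    (∀ r : ℝ, 0 < r → (Metric.ball z₀ r ∩ W).Nonempty)


/-! ## §1 Class bookkeeping (PROVED, as in LINE 22 / LINE 23) -/

/-- The class of a pinned profile (tree `isTypeIAncientMild_of_class`). -/
theorem class_of_pinned {C : ℝ} {U : ℝ → EuclideanSpace ℝ (Fin 3) → EuclideanSpace ℝ (Fin 3)} (hP : Pinned C U) : IsTypeIAncientMild C U :=
  PoloidalWindowDoorPoloidalWindowRigidityWindow.isTypeIAncientMild_of_class hP.1 hP.2.1 hP.2.2.1 hP.2.2.2.1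

/-- A pinned profile is not identically zero (`N = U₂(−1,0) ≠ 0`). -/
theorem pinned_absurd_of_zero {C : ℝ} {U : ℝ → EuclideanSpace ℝ (Fin 3) → EuclideanSpace ℝ (Fin 3)} (hP : Pinned C U)
    (hz : ∀ t < 0, ∀ x, U t x = 0) : False := by
  have hN : U (-1) 0 2 ≠ 0 := hP.2.2.2.2.2.1
  have h0 : U (-1) 0 = 0 := hz (-1) (by norm_num) 0
  exact hN (by rw [h0]; rfl)

/-- Components commute with the derivative: `D(y ↦ a(y)ᵢ)(x)h = (Da(x)h)ᵢ` (tree idiom, `…CriticalFluxDoorPressureIBP.fderiv_coord_apply`). -/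
theorem fderiv_coord_apply' {a : EuclideanSpace ℝ (Fin 3) → EuclideanSpace ℝ (Fin 3)} {x : EuclideanSpace ℝ (Fin 3)}
    (ha : DifferentiableAt ℝ a x) (i : Fin 3) (h : EuclideanSpace ℝ (Fin 3)) :
    fderiv ℝ (fun y => a y i) x h = fderiv ℝ a x h i := by
  have hc := ((EuclideanSpace.proj (𝕜 := ℝ) i).hasFDerivAt.comp x ha.hasFDerivAt).fderiv
  rw [show (fun y => a y i) = (EuclideanSpace.proj (𝕜 := ℝ) i) ∘ a from rfl, hc]
  rfl

/-! ## §2 R — VERTICAL RIGIDITY (PROVED BY NAME): the poloidal-axis component alone detects non-triviality -/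

/-- **R (vertical rigidity).**  A class-`C` profile which is e₂-poloidal at some time `s < 0` and whose vertical component vanishes identically at that
time is `≡ 0` on the whole past.  Two lines from the tree's `…SymmetryGerms.eq_zero_of_horizontalGradient_eq_zero_on_open` (which needs only `∂₀v₂ = 0` on
an open set at one poloidal time: `(v₀,v₁)` is then an `L^∞` conjugate-harmonic pair in every horizontal plane). -/
theorem verticalRigidity {C : ℝ} {v : ℝ → EuclideanSpace ℝ (Fin 3) → EuclideanSpace ℝ (Fin 3)}
    (hrate : HasTypeITimeDecay C v) (hcont : ContinuousOn (Function.uncurry v) (Set.Iio (0 : ℝ) ×ˢ Set.univ))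
    (hmild : ∀ s t : ℝ, s < t → t < 0 → ∀ x, v t x = UnboundedOperators.heatExtension (v s) (t - s) x - oseenDuhamel 1 s v v t x)
    (hdiv : ∀ t < 0, VectorCalculus.IsDivFree (v t)) {s : ℝ} (hs : s < 0)
    (hpol : ∀ y, ⟪curl (v s) y, EuclideanSpace.single 2 1⟫_ℝ = 0) (h2 : ∀ y, v s y 2 = 0) :
    ∀ t < 0, ∀ x, v t x = 0 := by
  have hA : AnalyticOnNhd ℝ (v s) Set.univ :=
    (PoloidalWindowDoorPoloidalWindowRigidityWindow.isTypeIAncientMild_of_class hrate hcont hmild hdiv).analyticOnNhd_slice_univ hs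
  refine PoloidalWindowDoorPoloidalWindowRigiditySymmetryGerms.eq_zero_of_horizontalGradient_eq_zero_on_open hrate hcont hmild hdiv hs
    hpol isOpen_univ Set.univ_nonempty fun y _ => ?_
  rw [← fderiv_coord_apply' ((hA y (Set.mem_univ y)).differentiableAt) 2]
  have hz : (fun y => v s y 2) = fun _ => (0 : ℝ) := funext h2
  rw [hz]
  simp

/-- R for pinned-class vocabulary: a class-`C` e₂-poloidal profile that is not `≡ 0` has `v₂(s,·) ≢ 0` at EVERY time `s < 0`. -/
theorem vertical_nonvanishing {C : ℝ} {v : ℝ → EuclideanSpace ℝ (Fin 3) → EuclideanSpace ℝ (Fin 3)}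
    (hrate : HasTypeITimeDecay C v) (hcont : ContinuousOn (Function.uncurry v) (Set.Iio (0 : ℝ) ×ˢ Set.univ))
    (hmild : ∀ s t : ℝ, s < t → t < 0 → ∀ x, v t x = UnboundedOperators.heatExtension (v s) (t - s) x - oseenDuhamel 1 s v v t x)
    (hdiv : ∀ t < 0, VectorCalculus.IsDivFree (v t))
    (hpol : ∀ s < 0, ∀ y, ⟪curl (v s) y, EuclideanSpace.single 2 1⟫_ℝ = 0) (hne : ¬ ∀ t < 0, ∀ x, v t x = 0) :
    ∀ s < 0, ∃ y, v s y 2 ≠ 0 := by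
  intro s hs
  by_contra h
  push Not at h
  exact hne (verticalRigidity hrate hcont hmild hdiv hs (hpol s hs) h)

/-! ## §3 U3a — the ANISOTROPIC GAP (hand, M) and the PIN LOWER BOUND (PROVED from it) -/

/-- **U3a `AnisotropicGap` (PROVABLE, M — hand target).**  For every Type-I constant `C` there is `δ = δ(C) > 0` such that every class-`C` e₂-poloidal profile
with `sup √(−t)|v₂| ≤ δ` is `≡ 0`.  Proof for the hand (template: the tree's `…PoloidalExtremal.exists_poloidal_extremal`, p469616, which runs exactly this
extraction): a violating sequence `vₙ` (`δ = 1/(n+1)`, `vₙ ≢ 0`) has points `(tₙ, xₙ)` with `√(−tₙ)‖vₙ(tₙ,xₙ)‖ > ε₀` by the ISOTROPIC gap (tree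
`SymmetricLiouville.Negative.exists_eps_small_vanishes` with `inClass_iff_isTypeIAncientMild`); the renormalised fields `√(−tₙ)·vₙ(−tₙ s, xₙ + √(−tₙ) y)` are class
`C` (`isTypeIAncientMild_zoomTranslate`), e₂-poloidal (`poloidal_nsRescale`, `poloidal_translate`), have `‖·(−1,0)‖ > ε₀` and `sup √(−s)|(·)₂| ≤ 1/(n+1)`;
a KNSS limit with gradients (`…Theorems.exists_tendsto_of_isTypeIAncientMild_seq`, `poloidal_of_tendsto`) is class `C`, poloidal, has `‖V(−1,0)‖ ≥ ε₀` and
`V₂ ≡ 0` — absurd by `verticalRigidity`. -/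
def AnisotropicGap : Prop :=
  ∀ C : ℝ, ∃ δ : ℝ, 0 < δ ∧ ∀ v : ℝ → EuclideanSpace ℝ (Fin 3) → EuclideanSpace ℝ (Fin 3), IsTypeIAncientMild C v →
    (∀ s < 0, ∀ y, ⟪curl (v s) y, EuclideanSpace.single 2 1⟫_ℝ = 0) →
    (∀ t < 0, ∀ x, Real.sqrt (-t) * |v t x 2| ≤ δ) → ∀ t < 0, ∀ x, v t x = 0

/-- **stub U3a — LANDED (v1.1)**: p709185 ACCEPTED `Theorems/PoloidalWindowDoorPoloidalWindowRigidityLeastPinAnisotropicGap.lean` (ns-es-p1 g8), decl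
`…LeastPinAnisotropicGap.anisotropicGap` = `AnisotropicGap` VERBATIM (critic idea-crit-7 g8 exact-string pin 08:33:15Z); wired BY NAME. -/
theorem stub_anisotropicGap : AnisotropicGap :=
  Summit.NavierStokesRegularity.NavierStokesRegularity.Theorems.PoloidalWindowDoorPoloidalWindowRigidityLeastPinAnisotropicGap.anisotropicGap

/-- **The pin is never shallow (PROVED from U3a):** every pinned class-`C` profile has `|N| = |v₂(−1,0)| ≥ δ(C)`. -/
theorem pin_lower_bound (hAG : AnisotropicGap) (C : ℝ) :
    ∃ δ : ℝ, 0 < δ ∧ ∀ v : ℝ → EuclideanSpace ℝ (Fin 3) → EuclideanSpace ℝ (Fin 3), Pinned C v → δ ≤ |v (-1) 0 2| := by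
  obtain ⟨δ, hδ, hgap⟩ := hAG C
  refine ⟨δ, hδ, fun v hP => ?_⟩
  by_contra hlt
  have hlt' : |v (-1) 0 2| < δ := lt_of_not_ge hlt
  exact pinned_absurd_of_zero hP
    (hgap v (class_of_pinned hP) hP.2.2.2.2.1 (fun t ht x => (hP.2.2.2.2.2.2.1 t ht x).trans hlt'.le))

/-! ## §4 COMPACTNESS of the pinned–peakless class WITH its nondegeneracy (PROVED; the tree's `classCompactness` with the common pin value replaced by a
lower bound) -/

/-- **`PinnedCompact`**: a sequence of pinned peakless class-`C` profiles whose pin values stay `≥ δ > 0` in absolute value has a subsequence converging —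
locally uniformly on every slice, the vorticity slice at `−1` as well — to a PINNED PEAKLESS class-`C` profile. -/
def PinnedCompact : Prop :=
  ∀ (C δ : ℝ) (vs : ℕ → ℝ → EuclideanSpace ℝ (Fin 3) → EuclideanSpace ℝ (Fin 3)), 0 < δ →
    (∀ k, Pinned C (vs k)) → (∀ k, Peakless (vs k)) → (∀ k, δ ≤ |vs k (-1) 0 2|) →
      ∃ (φ : ℕ → ℕ) (U : ℝ → EuclideanSpace ℝ (Fin 3) → EuclideanSpace ℝ (Fin 3)), StrictMono φ ∧ Pinned C U ∧ Peakless U ∧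
        (∀ t < 0, TendstoLocallyUniformly (fun j => vs (φ j) t) (U t) Filter.atTop) ∧
        TendstoLocallyUniformly (fun j => curl (vs (φ j) (-1))) (curl (U (-1))) Filter.atTop

/-- **`PinnedCompact` PROVED** (KNSS extraction with gradients `…Theorems.exists_tendsto_of_isTypeIAncientMild_seq`; poloidality by `poloidal_of_tendsto`; the pin
value of the limit is the limit of the pin values, `≥ δ` hence `≠ 0`; the Type-I extremality passes to the limit; the three pins by Fermat — tree
`threadPin_of_hotSpot`, `threadSignedPin`; `Peakless` by tree `peaklessClosed`; vorticity slices by `curl = curlCLM ∘ D`).  Adapted line by line from the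
tree's `…HotHullCompactness.classCompactness` (K2-p2 g14). -/
theorem pinnedCompact : PinnedCompact := by
  intro C δ vs hδ hP hK hNδ
  have hw : ∀ k, IsTypeIAncientMild C (vs k) := fun k => class_of_pinned (hP k)
  obtain ⟨φ, hφ, W, hW, hpt, hfd, htlu, htlufd⟩ := exists_tendsto_of_isTypeIAncientMild_seq C hw
  have hrate : HasTypeITimeDecay C W := hW.2.2.2
  have hcont : ContinuousOn (Function.uncurry W) (Set.Iio (0 : ℝ) ×ˢ Set.univ) := hW.1.continuousOn
  have hmild : ∀ s t : ℝ, s < t → t < 0 → ∀ x, W t x =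
      UnboundedOperators.heatExtension (W s) (t - s) x - oseenDuhamel 1 s W W t x :=
    fun s t hst ht x => hW.mild_eq_heatExtension hst ht x
  have hdiv : ∀ t < 0, VectorCalculus.IsDivFree (W t) := hW.2.1
  have hpol : ∀ s < 0, ∀ y, ⟪curl (W s) y, EuclideanSpace.single 2 1⟫_ℝ = 0 :=
    fun s hs y => PoloidalWindowDoorPoloidalWindowRigidityPoloidalExtremal.poloidal_of_tendsto (hfd s hs y)
      (fun j => (hP (φ j)).2.2.2.2.1 s hs y)
  have hc2 : Continuous fun x : EuclideanSpace ℝ (Fin 3) => x 2 := by fun_prop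
  have hval : ∀ t < 0, ∀ x, Tendsto (fun j => vs (φ j) t x 2) atTop (𝓝 (W t x 2)) :=
    fun t ht x => (hc2.tendsto _).comp (hpt t ht x)
  -- the pin values converge to the pin value of the limit, which is therefore `≥ δ > 0` in absolute value
  have hNabs : Tendsto (fun j => |vs (φ j) (-1) 0 2|) atTop (𝓝 |W (-1) 0 2|) :=
    (continuous_abs.tendsto _).comp (hval (-1) (by norm_num) 0)
  have hNge : δ ≤ |W (-1) 0 2| := ge_of_tendsto hNabs (Eventually.of_forall fun j => hNδ (φ j))
  have hne : W (-1) 0 2 ≠ 0 := by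
    intro h0
    rw [h0, abs_zero] at hNge
    exact absurd hNge (not_le.2 hδ)
  -- the Type-I extremality passes to the limit
  have hhot : ∀ t < 0, ∀ x, Real.sqrt (-t) * |W t x 2| ≤ |W (-1) 0 2| := by
    intro t ht x
    have hlim : Tendsto (fun j => Real.sqrt (-t) * |vs (φ j) t x 2|) atTop (𝓝 (Real.sqrt (-t) * |W t x 2|)) :=
      ((continuous_const.mul continuous_abs).tendsto _).comp (hval t ht x)
    exact le_of_tendsto_of_tendsto hlim hNabs (Eventually.of_forall fun j => (hP (φ j)).2.2.2.2.2.2.1 t ht x)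
  -- the pins re-derive themselves by Fermat at the hot spot of the limit
  have hPW : Pinned C W :=
    ⟨hrate, hcont, hmild, hdiv, hpol, hne, hhot,
      PoloidalWindowDoorLrcModEntireThreadPins.threadPin_of_hotSpot hrate hcont hmild hhot,
      PoloidalWindowDoorLrcModEntireThreadPins.threadSignedPin C W hrate hcont hmild hdiv hne hhot⟩
  -- `Peakless` passes to the limit
  have hKW : Peakless W :=
    PoloidalWindowDoorPoloidalWindowRigidityHotHullCompactness.peaklessClosed (fun j => vs (φ j)) W (fun j => hK (φ j))
      (fun j t ht => PoloidalWindowDoorPoloidalWindowRigidityHotHullCompactness.continuous_slice_of_class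
        (hP (φ j)).1 (hP (φ j)).2.1 (hP (φ j)).2.2.1 (hP (φ j)).2.2.2.1 ht)
      (fun t ht => PoloidalWindowDoorPoloidalWindowRigidityHotHullCompactness.continuous_slice_of_class hrate hcont hmild hdiv ht)
      (fun t ht => htlu t ht)
  -- vorticity slices converge locally uniformly: `curl = curlCLM ∘ D`
  have hcurl : TendstoLocallyUniformly (fun j => curl (vs (φ j) (-1))) (curl (W (-1))) atTop := by
    have e1 : (fun j => curl (vs (φ j) (-1))) = fun j => curlCLM ∘ fderiv ℝ (vs (φ j) (-1)) := by
      funext j x; exact curl_eq_curlCLM _ _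
    have e2 : curl (W (-1)) = curlCLM ∘ fderiv ℝ (W (-1)) := by
      funext x; exact curl_eq_curlCLM _ _
    rw [e1, e2]
    exact curlCLM.uniformContinuous.comp_tendstoLocallyUniformly (htlufd (-1) (by norm_num))
  exact ⟨φ, W, hφ, hPW, hKW, fun t ht => htlu t ht, hcurl⟩

/-! ## §5 LEAST-PIN profiles exist (PROVED from U3a) -/

/-- **Least pin.**  `v` has the least pin value among all pinned peakless class-`C` profiles. -/
def LeastPin (C : ℝ) (v : ℝ → EuclideanSpace ℝ (Fin 3) → EuclideanSpace ℝ (Fin 3)) : Prop :=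
  ∀ v' : ℝ → EuclideanSpace ℝ (Fin 3) → EuclideanSpace ℝ (Fin 3), Pinned C v' → Peakless v' → |v (-1) 0 2| ≤ |v' (-1) 0 2|

/-- **A least-pin profile exists (PROVED)**: if the pinned–peakless class 𝒫(C) is nonempty it contains a profile of least `|N|` (minimising sequence; the infimum is
`≥ δ(C) > 0` by `pin_lower_bound`, so `pinnedCompact` applies and the limit is a non-degenerate pinned peakless profile whose pin value is the infimum). -/
theorem exists_leastPin (hAG : AnisotropicGap) {C : ℝ} {v₀ : ℝ → EuclideanSpace ℝ (Fin 3) → EuclideanSpace ℝ (Fin 3)}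
    (hP₀ : Pinned C v₀) (hK₀ : Peakless v₀) :
    ∃ U : ℝ → EuclideanSpace ℝ (Fin 3) → EuclideanSpace ℝ (Fin 3), Pinned C U ∧ Peakless U ∧ LeastPin C U := by
  obtain ⟨δ, hδ, hδle⟩ := pin_lower_bound hAG C
  set S : Set ℝ := {r | ∃ v' : ℝ → EuclideanSpace ℝ (Fin 3) → EuclideanSpace ℝ (Fin 3), Pinned C v' ∧ Peakless v' ∧ r = |v' (-1) 0 2|}
    with hS
  have hSne : S.Nonempty := ⟨_, v₀, hP₀, hK₀, rfl⟩
  have hSδ : ∀ r ∈ S, δ ≤ r := by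
    rintro r ⟨v', hP', -, rfl⟩
    exact hδle v' hP'
  have hSbdd : BddBelow S := ⟨δ, hSδ⟩
  set m : ℝ := sInf S with hm
  have hmle : ∀ r ∈ S, m ≤ r := fun r hr => csInf_le hSbdd hr
  have hkpos : ∀ k : ℕ, (0 : ℝ) < 1 / ((k : ℝ) + 1) := fun k => by positivity
  have hseq : ∀ k : ℕ, ∃ r ∈ S, r < m + 1 / ((k : ℝ) + 1) := fun k =>
    exists_lt_of_csInf_lt hSne (by linarith [hkpos k])
  choose r hrS hrlt using hseq
  have hvs : ∀ k, ∃ v' : ℝ → EuclideanSpace ℝ (Fin 3) → EuclideanSpace ℝ (Fin 3), Pinned C v' ∧ Peakless v' ∧ r k = |v' (-1) 0 2| :=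
    fun k => hrS k
  choose vs hPk hKk hrk using hvs
  obtain ⟨φ, U, hφ, hPU, hKU, hconv, -⟩ :=
    pinnedCompact C δ vs hδ hPk hKk (fun k => (hrk k) ▸ hSδ _ (hrS k))
  -- the pin value of `U` is the infimum `m`
  have hc2 : Continuous fun x : EuclideanSpace ℝ (Fin 3) => x 2 := by fun_prop
  have hval : Tendsto (fun j => |vs (φ j) (-1) 0 2|) atTop (𝓝 |U (-1) 0 2|) :=
    (continuous_abs.tendsto _).comp ((hc2.tendsto _).comp
      (((hconv (-1) (by norm_num)).tendstoLocallyUniformlyOn (s := Set.univ)).tendsto_at (Set.mem_univ 0)))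
  have hup : ∀ j : ℕ, |vs (φ j) (-1) 0 2| ≤ m + 1 / ((j : ℝ) + 1) := by
    intro j
    rw [← hrk (φ j)]
    refine (hrlt (φ j)).le.trans ?_
    have hj : (j : ℝ) ≤ ((φ j : ℕ) : ℝ) := by exact_mod_cast hφ.id_le j
    have hj1 : (j : ℝ) + 1 ≤ ((φ j : ℕ) : ℝ) + 1 := by linarith
    have hjpos : (0 : ℝ) < (j : ℝ) + 1 := by positivity
    have hdiv' : 1 / (((φ j : ℕ) : ℝ) + 1) ≤ 1 / ((j : ℝ) + 1) := one_div_le_one_div_of_le hjpos hj1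
    linarith
  have hlow : ∀ j : ℕ, m ≤ |vs (φ j) (-1) 0 2| := by
    intro j
    rw [← hrk (φ j)]
    exact hmle _ (hrS _)
  have hlim1 : Tendsto (fun j : ℕ => m + 1 / ((j : ℝ) + 1)) atTop (𝓝 m) := by
    have h0 : Tendsto (fun j : ℕ => 1 / ((j : ℝ) + 1)) atTop (𝓝 0) := tendsto_one_div_add_atTop_nhds_zero_nat
    have h1 := h0.const_add m
    simpa using h1
  have hNm : |U (-1) 0 2| = m :=
    le_antisymm (le_of_tendsto_of_tendsto hval hlim1 (Eventually.of_forall hup)) (ge_of_tendsto hval (Eventually.of_forall hlow))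
  refine ⟨U, hPU, hKU, fun v' hP' hK' => ?_⟩
  rw [hNm]
  exact hmle _ ⟨v', hP', hK', rfl⟩

/-- Least pin is a property of the pin VALUE: the translate of a least-pin profile to any of its hot points is again least-pin (with hot_hull H1
`pinned_translate` / `peakless_translate` this makes every hot point of a least-pin profile a least pin). -/
theorem leastPin_hot_translate {C : ℝ} {v : ℝ → EuclideanSpace ℝ (Fin 3) → EuclideanSpace ℝ (Fin 3)} (hL : LeastPin C v)
    {y : EuclideanSpace ℝ (Fin 3)} (hy : y ∈ hotSet v) : LeastPin C (fun t x => v t (x + y)) := by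
  intro v' hP' hK'
  have h : (fun t x => v t (x + y)) (-1) 0 2 = v (-1) 0 2 := by
    show v (-1) (0 + y) 2 = v (-1) 0 2
    rw [zero_add]
    exact hy.2
  rw [h]
  exact hL v' hP' hK'

/-! ## §6 U3b — NO-PIN-LOSS for least-pin profiles (hand, M) -/

/-- **No pin loss.**  Every class-`C`, e₂-poloidal, peakless profile `V ≢ 0` dominated by the pin of `v` (`√(−t)|V₂| ≤ |N|` everywhere) carries the FULL pin:
`sup √(−t)|V₂| = |N|`.  (The domination is automatic for every renormalisation descendant of `v` — blow-downs, tangent flows, spatial-translation limits,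
time-shifts, hot-hull limits — so each of them is `0` or full-pin.) -/
def NoPinLoss (C : ℝ) (v : ℝ → EuclideanSpace ℝ (Fin 3) → EuclideanSpace ℝ (Fin 3)) : Prop :=
  ∀ V : ℝ → EuclideanSpace ℝ (Fin 3) → EuclideanSpace ℝ (Fin 3), IsTypeIAncientMild C V →
    (∀ s < 0, ∀ y, ⟪curl (V s) y, EuclideanSpace.single 2 1⟫_ℝ = 0) → Peakless V →
    (∀ t < 0, ∀ x, Real.sqrt (-t) * |V t x 2| ≤ |v (-1) 0 2|) → (¬ ∀ t < 0, ∀ x, V t x = 0) →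
    ∀ η > 0, ∃ t < 0, ∃ x, |v (-1) 0 2| - η < Real.sqrt (-t) * |V t x 2|

/-- **stub U3b `NoPinLoss` for least-pin profiles — LANDED (v1.1)**: p709332 ACCEPTED 08:29:04Z `Theorems/PoloidalWindowDoorPoloidalWindowRigidityLeastPinNoPinLoss.lean`
(ns-es-p1 g8), decl `…LeastPinNoPinLoss.noPinLoss` = this statement VERBATIM (+ S-lemma `peakless_nsRescale`); wired BY NAME.  Original hand brief:  Proof for the hand: if `m' := sup √(−t)|V₂| < |N|` (`m' > 0` by
`vertical_nonvanishing`), take near-sup points `(t_k, x_k)`; the renormalised fields `√(−t_k)·V(−t_k s, x_k + √(−t_k) y)` are class `C`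
(`isTypeIAncientMild_zoomTranslate`), e₂-poloidal (`poloidal_nsRescale`, `poloidal_translate`), peakless (`peakless_translate` + the S-lemma «`Peakless` is
invariant under `nsRescale c`, `c > 0`»: horizontal planes and island brackets are mapped to horizontal planes and island brackets), dominated by `m'`, with
`|(·)₂(−1,0)| → m'`; a KNSS limit with gradients (`exists_tendsto_of_isTypeIAncientMild_seq`) is class `C`, poloidal (`poloidal_of_tendsto`), peakless
(`peaklessClosed`), attains `m' = |V̄₂(−1,0)|` with `√(−t)|V̄₂| ≤ m'` — hence PINNED by Fermat (`threadPin_of_hotSpot`, `threadSignedPin`, as in `pinnedCompact`) —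
with pin value `m' < |N|`: this contradicts `LeastPin C v`.  TEMPLATE: tree p469616 (`exists_poloidal_extremal`: near-maximal points + renormalisation +
gradient limit). -/
theorem stub_noPinLoss : AnisotropicGap → ∀ (C : ℝ) (v : ℝ → EuclideanSpace ℝ (Fin 3) → EuclideanSpace ℝ (Fin 3)),
    Pinned C v → Peakless v → LeastPin C v → NoPinLoss C v :=
  Summit.NavierStokesRegularity.NavierStokesRegularity.Theorems.PoloidalWindowDoorPoloidalWindowRigidityLeastPinNoPinLoss.noPinLoss

/-- Corner of U3b that needs no hand: the pin of `v` itself is dominated and attained (`t = −1`, `x = 0`). -/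
theorem noPinLoss_self {C : ℝ} {v : ℝ → EuclideanSpace ℝ (Fin 3) → EuclideanSpace ℝ (Fin 3)} (hP : Pinned C v) :
    ∀ η > 0, ∃ t < 0, ∃ x, |v (-1) 0 2| - η < Real.sqrt (-t) * |v t x 2| := by
  intro η hη
  refine ⟨-1, by norm_num, 0, ?_⟩
  have h1 : Real.sqrt (-(-1 : ℝ)) = 1 := by norm_num
  rw [h1, one_mul]
  linarith


/-! ## §7 THICKNESS of the least-pin profile at its pin, mod the (TH)-germ = S0 — hot_hull v1.7 H2, VERBATIM (S0 entering as a HYPOTHESIS) -/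

/-- **S0 ((TH) column's `stub_localTHEmptyHypNUGRS`), as a statement** — VERBATIM the type of hot_split / hot_hull / twist_split's shared stub; this line takes it
as an explicit binder `hS0` instead of a sorried stub. -/
def S0Statement : Prop :=
    ∀ (u : ℝ → EuclideanSpace ℝ (Fin 3) → EuclideanSpace ℝ (Fin 3)) (μ A : ℝ → ℝ → ℝ)
      (U : Set (ℝ × EuclideanSpace ℝ (Fin 3))) (p₀ : ℝ × EuclideanSpace ℝ (Fin 3)),
      IsOpen U → p₀ ∈ U →
      AnalyticOnNhd ℝ (Function.uncurry u) U →
      (∀ p ∈ U, AnalyticAt ℝ (Function.uncurry μ) (p.1, p.2 2)) →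
      (∀ p ∈ U, AnalyticAt ℝ (Function.uncurry A) (p.1, p.2 2)) →
      (∀ p ∈ U, fderiv ℝ (u p.1) p.2 (EuclideanSpace.single 0 1) 1 = fderiv ℝ (u p.1) p.2 (EuclideanSpace.single 1 1) 0) →
      (∀ p ∈ U, fderiv ℝ (u p.1) p.2 (EuclideanSpace.single 0 1) 0 + fderiv ℝ (u p.1) p.2 (EuclideanSpace.single 1 1) 1 +
        fderiv ℝ (u p.1) p.2 (EuclideanSpace.single 2 1) 2 = 0) →
      (∀ p ∈ U, ∀ b : Fin 3, b ≠ 2 →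
        fderiv ℝ (u p.1) p.2 (EuclideanSpace.single 2 1) b =
          μ p.1 (p.2 2) * fderiv ℝ (u p.1) p.2 (EuclideanSpace.single b 1) 2) →
      (∀ p ∈ U,
        (1 - μ p.1 (p.2 2)) *
            (deriv (fun s => u s p.2 2) p.1 + fderiv ℝ (fun y => u p.1 y 2) p.2 (u p.1 p.2)
              - Δ (fun y => u p.1 y 2) p.2) =
          A p.1 (p.2 2) + (deriv (fun s => μ s (p.2 2)) p.1 - deriv (deriv (μ p.1)) (p.2 2)) * u p.1 p.2 2
            + deriv (μ p.1) (p.2 2) / 2 * u p.1 p.2 2 ^ 2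
            - 2 * deriv (μ p.1) (p.2 2) * fderiv ℝ (u p.1) p.2 (EuclideanSpace.single 2 1) 2) →
      fderiv ℝ (fun y => fderiv ℝ (u p₀.1) y (EuclideanSpace.single 2 1) 2) p₀.2 (EuclideanSpace.single 0 1) *
            fderiv ℝ (u p₀.1) p₀.2 (EuclideanSpace.single 1 1) 2 -
          fderiv ℝ (fun y => fderiv ℝ (u p₀.1) y (EuclideanSpace.single 2 1) 2) p₀.2 (EuclideanSpace.single 1 1) *
            fderiv ℝ (u p₀.1) p₀.2 (EuclideanSpace.single 0 1) 2 ≠ 0 →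
      μ p₀.1 (p₀.2 2) ≠ 0 → μ p₀.1 (p₀.2 2) ≠ 1 → deriv (μ p₀.1) (p₀.2 2) ≠ 0 →
      μ p₀.1 (p₀.2 2) < 0 →
      (fderiv ℝ (u p₀.1) p₀.2 (EuclideanSpace.single 0 1) 0 ≠ fderiv ℝ (u p₀.1) p₀.2 (EuclideanSpace.single 1 1) 1 ∨
        fderiv ℝ (u p₀.1) p₀.2 (EuclideanSpace.single 1 1) 0 ≠ 0) →
      u p₀.1 p₀.2 = 0 →
      fderiv ℝ (u p₀.1) p₀.2 (EuclideanSpace.single 0 1) 2 = 0 →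
      fderiv ℝ (u p₀.1) p₀.2 (EuclideanSpace.single 1 1) 2 = 1 → False

/-- **The (TH)-germ statement** — VERBATIM hot_hull v1.7 `THGerm` (the conclusion of tree `…TwistingTHLocalHypGerm.stub_twistingTH_of_localEmptyHyp`). -/
def THGerm : Prop :=
  ∀ (C : ℝ) (v : ℝ → EuclideanSpace ℝ (Fin 3) → EuclideanSpace ℝ (Fin 3)),
    Literature.Analysis.FluidPDE.HasTypeITimeDecay C v →
    ContinuousOn (Function.uncurry v) (Set.Iio (0 : ℝ) ×ˢ Set.univ) →
    (∀ s t : ℝ, s < t → t < 0 → ∀ x, v t x =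
      Literature.Analysis.UnboundedOperators.heatExtension (v s) (t - s) x -
        Literature.Analysis.FluidPDE.oseenDuhamel 1 s v v t x) →
    (∀ t < 0, Literature.Analysis.FluidPDE.VectorCalculus.IsDivFree (v t)) →
    (∀ s < 0, ∀ y, ⟪Literature.Analysis.FluidPDE.curl (v s) y, EuclideanSpace.single 2 1⟫_ℝ = 0) →
    ∀ W : Set (ℝ × EuclideanSpace ℝ (Fin 3)), IsOpen W → W.Nonempty → W ⊆ Set.Iio (0 : ℝ) ×ˢ Set.univ →
      (∀ z ∈ W, (Literature.Analysis.FluidPDE.curl (v z.1) z.2 ≠ 0 ∧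
          (fderiv ℝ (v z.1) z.2 (EuclideanSpace.single 0 1) 2 ≠ 0 ∨ fderiv ℝ (v z.1) z.2 (EuclideanSpace.single 1 1) 2 ≠ 0) ∧
          (fderiv ℝ (v z.1) z.2 (EuclideanSpace.single 2 1) 0 ≠ 0 ∨ fderiv ℝ (v z.1) z.2 (EuclideanSpace.single 2 1) 1 ≠ 0))) →
      (∀ m : ℝ → ℝ, ∀ W₁ : Set (ℝ × EuclideanSpace ℝ (Fin 3)), W₁ ⊆ W → IsOpen W₁ → W₁.Nonempty →
          ∃ z ∈ W₁, ∃ b : Fin 3, b ≠ 2 ∧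
            fderiv ℝ (v z.1) z.2 (EuclideanSpace.single 2 1) b ≠
              m z.1 * fderiv ℝ (v z.1) z.2 (EuclideanSpace.single b 1) 2) →
      (∀ z ∈ W, (fderiv ℝ (fun x => fderiv ℝ (v z.1) x (EuclideanSpace.single 2 1) 2) z.2 (EuclideanSpace.single 0 1) *
              fderiv ℝ (v z.1) z.2 (EuclideanSpace.single 1 1) 2 -
            fderiv ℝ (fun x => fderiv ℝ (v z.1) x (EuclideanSpace.single 2 1) 2) z.2 (EuclideanSpace.single 1 1) *
              fderiv ℝ (v z.1) z.2 (EuclideanSpace.single 0 1) 2 ≠ 0)) →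
      (∃ m : ℝ → ℝ → ℝ, ∀ z ∈ W, ∀ b : Fin 3, b ≠ 2 →
          fderiv ℝ (v z.1) z.2 (EuclideanSpace.single 2 1) b =
            m z.1 (z.2 2) * fderiv ℝ (v z.1) z.2 (EuclideanSpace.single b 1) 2) →
      ∃ s : ℝ, s < 0 ∧ ∃ U : Set (EuclideanSpace ℝ (Fin 3)), IsOpen U ∧ U.Nonempty ∧
        ((∃ e : EuclideanSpace ℝ (Fin 3), e ≠ 0 ∧
            ∀ y ∈ U, fderiv ℝ (Literature.Analysis.FluidPDE.curl (v s)) y e = 0) ∨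
         (∃ c : EuclideanSpace ℝ (Fin 3), ∀ y ∈ U,
            Literature.Analysis.FluidPDE.rotGen (Literature.Analysis.FluidPDE.curl (v s) y) =
              fderiv ℝ (Literature.Analysis.FluidPDE.curl (v s)) y (Literature.Analysis.FluidPDE.rotGen (y - c))) ∨
         (∃ w : EuclideanSpace ℝ (Fin 3) → EuclideanSpace ℝ (Fin 3), AnalyticOnNhd ℝ w Set.univ ∧
            ¬ BddAbove (Set.range fun y => ‖w y‖) ∧ ∀ y ∈ U, v s y = w y))

/-- **THGerm ⇐ S0, BY NAME** through the tree chain `localTHEmptyHypNF_of_normalFormRS` → `localTHEmptyHypNonUmbilic_of_galilean` →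
`localTHEmptyHyp_of_localTHEmptyHypNonUmbilic` → `stub_twistingTH_of_localEmptyHyp` (all landed) — hot_hull's `thGerm_holds` with S0 as the binder `hS0`. -/
theorem thGerm_of_S0 (hS0 : S0Statement) : THGerm :=
  PoloidalWindowDoorLrcModEntireTwistingTHLocalHypGerm.stub_twistingTH_of_localEmptyHyp
    (PoloidalWindowDoorLrcModEntireTwistingTHLocalNonUmbilic.localTHEmptyHyp_of_localTHEmptyHypNonUmbilic
      (PoloidalWindowDoorLrcModEntireTwistingTHLocalGalilean.localTHEmptyHypNonUmbilic_of_galilean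
        (PoloidalWindowDoorLrcModEntireTwistingTHLocalNormalFormRS.localTHEmptyHypNF_of_normalFormRS hS0)))

/-- **H2 `ThickDense`**: given the (TH)-germ statement, EVERY space-time point `z₀` (with `z₀.1 < 0`) of EVERY pinned profile carries a thick window
accumulating at `z₀`.  (So thickness is not a property of the pin: it holds everywhere, off the leaf included — the theorem form of the g9 seed
"use thickness off the leaf".) -/
def ThickDense : Prop :=
  THGerm → ∀ (C : ℝ) (v : ℝ → EuclideanSpace ℝ (Fin 3) → EuclideanSpace ℝ (Fin 3)), Pinned C v →
    ∀ z₀ : ℝ × EuclideanSpace ℝ (Fin 3), z₀.1 < 0 → ∃ W : Set (ℝ × EuclideanSpace ℝ (Fin 3)), ThickWindowAt v W z₀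

/-- **H2 PROVED** from the tree: `…ThreadDichotomy.threadDichotomy` (5 cases) at `z₀`; case (i) IS a thick window at `z₀`; (ii) untwisted ⇒ a germ by
tree `…UntwistedGerm.stub_untwistedGerm` ⇒ absurd on a non-degenerate window by tree `…LrcModEntireIff.false_of_germ_of_nondegenerate`; (iii) (TH) ⇒ the
same via `THGerm`; (iv) time-only slope ⇒ `v ≡ 0` by tree `…FarThreadReduction.eq_zero_of_local_timeOnlySlope`; (v) degenerate ⇒ `v ≡ 0` by tree
`…SymmetryGerms.eq_zero_of_curl_eq_zero_on_open` / `eq_zero_of_horizontalGradient_eq_zero_on_open` / `…VerticalShearGerm.eq_zero_of_verticalShear_eq_zero_on_open`;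
`v ≡ 0` contradicts `N ≠ 0`. -/
theorem thickDense_holds : ThickDense := by
  intro hTH C v hP z₀ hz₀
  obtain ⟨hrate, hcont, hmild, hdiv, hpol, hne, -, -, -⟩ := hP
  have habs : ¬ (∀ t < 0, ∀ x, v t x = 0) := fun h0 => hne (by rw [h0 (-1) (by norm_num) 0]; rfl)
  have hgermAbs : ∀ W : Set (ℝ × EuclideanSpace ℝ (Fin 3)), W.Nonempty → W ⊆ Set.Iio (0 : ℝ) ×ˢ Set.univ →
      (∀ z ∈ W, Literature.Analysis.FluidPDE.curl (v z.1) z.2 ≠ 0 ∧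
          (fderiv ℝ (v z.1) z.2 (EuclideanSpace.single 0 1) 2 ≠ 0 ∨ fderiv ℝ (v z.1) z.2 (EuclideanSpace.single 1 1) 2 ≠ 0) ∧
          (fderiv ℝ (v z.1) z.2 (EuclideanSpace.single 2 1) 0 ≠ 0 ∨ fderiv ℝ (v z.1) z.2 (EuclideanSpace.single 2 1) 1 ≠ 0)) →
      (∃ s : ℝ, s < 0 ∧ ∃ U : Set (EuclideanSpace ℝ (Fin 3)), IsOpen U ∧ U.Nonempty ∧
        ((∃ e : EuclideanSpace ℝ (Fin 3), e ≠ 0 ∧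
            ∀ y ∈ U, fderiv ℝ (Literature.Analysis.FluidPDE.curl (v s)) y e = 0) ∨
         (∃ c : EuclideanSpace ℝ (Fin 3), ∀ y ∈ U,
            Literature.Analysis.FluidPDE.rotGen (Literature.Analysis.FluidPDE.curl (v s) y) =
              fderiv ℝ (Literature.Analysis.FluidPDE.curl (v s)) y (Literature.Analysis.FluidPDE.rotGen (y - c))) ∨
         (∃ w : EuclideanSpace ℝ (Fin 3) → EuclideanSpace ℝ (Fin 3), AnalyticOnNhd ℝ w Set.univ ∧
            ¬ BddAbove (Set.range fun y => ‖w y‖) ∧ ∀ y ∈ U, v s y = w y))) → False := by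
    intro W hWne hWs hnd hgerm
    obtain ⟨z₁, hz₁⟩ := hWne
    obtain ⟨s, hs', U, hU, hUne, hg⟩ := hgerm
    exact PoloidalWindowDoorLrcModEntireIff.false_of_germ_of_nondegenerate hrate hcont hmild hdiv hpol
      (Set.mem_prod.1 (hWs hz₁)).1 (hnd z₁ hz₁).1 hs' hU hUne hg
  rcases PoloidalWindowDoorLrcModEntireThreadDichotomy.threadDichotomy C v hrate hcont hmild hdiv hpol z₀ hz₀ with
    ⟨W, hW, hWs, hndtw, hthick, hacc⟩ | ⟨W, hW, hWne, hWs, hnd, htw0⟩ | ⟨W, hW, hWne, hWs, hnd, hpin', htw, hTH'⟩ |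
    ⟨W, hW, hWne, hWs, m, hm⟩ | ⟨s, hs', U, hU, hUne, hdeg⟩
  · exact ⟨W, hW, hWs, hndtw, hthick, hacc⟩
  · exact (hgermAbs W hWne hWs hnd (PoloidalWindowDoorLrcModEntireUntwistedGerm.stub_untwistedGerm C v hrate hcont hmild hdiv hpol
      W hW hWne hWs hnd htw0)).elim
  · exact (hgermAbs W hWne hWs hnd (hTH C v hrate hcont hmild hdiv hpol W hW hWne hWs hnd hpin' htw hTH')).elim
  · exact (habs (PoloidalWindowDoorLrcModEntireFarThreadReduction.eq_zero_of_local_timeOnlySlope hrate hcont hmild hdiv hpol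
      hW hWne hWs hm)).elim
  · rcases hdeg with hcurl | hflat | hrig
    · exact (habs (PoloidalWindowDoorPoloidalWindowRigiditySymmetryGerms.eq_zero_of_curl_eq_zero_on_open hrate hcont hmild hdiv
        hs' hU hUne hcurl)).elim
    · exact (habs (PoloidalWindowDoorPoloidalWindowRigiditySymmetryGerms.eq_zero_of_horizontalGradient_eq_zero_on_open hrate hcont hmild hdiv
        hs' (hpol s hs') hU hUne fun y hy => (hflat y hy).1)).elim
    · exact (habs (PoloidalWindowDoorPoloidalWindowRigidityVerticalShearGerm.eq_zero_of_verticalShear_eq_zero_on_open hrate hcont hmild hdiv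
        hs' hU hUne hrig)).elim

/-- **H2 at the pin of any pinned profile**: `ThickDense → THGerm → ∃ W, ThickWindow v W` (`ThickWindowAt v W (−1,0)` is `ThickWindow v W` definitionally). -/
theorem thickWindow_of_dense (hTD : ThickDense) (hTH : THGerm) {C : ℝ} {v : ℝ → EuclideanSpace ℝ (Fin 3) → EuclideanSpace ℝ (Fin 3)}
    (hP : Pinned C v) : ∃ W : Set (ℝ × EuclideanSpace ℝ (Fin 3)), ThickWindow v W :=
  hTD hTH C v hP ((-1 : ℝ), (0 : EuclideanSpace ℝ (Fin 3))) (by show (-1 : ℝ) < 0; norm_num)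

/-! ## §8 The research cell LEAST-PIN (OPEN): HL3′'s binders + least pin + no-pin-loss + the gap as data -/

/-- **Research cell LEAST-PIN (OPEN).**  Kill a pinned, thick, peakless class-`C` profile which in addition is a LEAST-PIN profile obeying NO-PIN-LOSS, the
anisotropic gap being available as data.  Every cut of HL3′ in the column whose kernel fixes `(v, W)` (hot_split C2a′/C2b′, leaf_uniform, null_leaf,
hot_forest, hot_hull RECURRENT-LEAF / ESC-END, uniform_return DEFECTIVE-RETURN-LEAF, eternal_core …-CORE) may thread the two extra binders through its own
kernel unchanged (mechanical, S), so each of those cells inherits the WLOG.  Compatible normal forms (not restated here): `C = C⋆` least (tree H1,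
`exists_poloidal_extremal`), hot-point re-centring (hot_hull H1 + `leastPin_hot_translate`). -/
def CellLeastPin : Prop :=
  AnisotropicGap →
  ∀ (C : ℝ) (v : ℝ → EuclideanSpace ℝ (Fin 3) → EuclideanSpace ℝ (Fin 3)) (W : Set (ℝ × EuclideanSpace ℝ (Fin 3))),
    Pinned C v → ThickWindow v W → Peakless v → LeastPin C v → NoPinLoss C v → False

/-! ## §9 Kernel (checked, no sorry): HL3′ ⇐ U3a ∧ U3b ∧ THGerm ∧ LEAST-PIN -/

/-- **HL3′** — VERBATIM the statement of hot_loops v4.3 `stub_peaklessEmpty` = hot_hull v1.7 `hotHull_peaklessEmpty` = the third argument of the tree's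
`…HotLoopsReduction.poloidalWindowRigidity_of_NUGRS_of_growth_of_peakless`. -/
def HL3' : Prop :=
    ∀ (C : ℝ) (v : ℝ → EuclideanSpace ℝ (Fin 3) → EuclideanSpace ℝ (Fin 3)),
      Literature.Analysis.FluidPDE.HasTypeITimeDecay C v →
      ContinuousOn (Function.uncurry v) (Set.Iio (0 : ℝ) ×ˢ Set.univ) →
      (∀ s t : ℝ, s < t → t < 0 → ∀ x, v t x =
        Literature.Analysis.UnboundedOperators.heatExtension (v s) (t - s) x -
          Literature.Analysis.FluidPDE.oseenDuhamel 1 s v v t x) →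
      (∀ t < 0, Literature.Analysis.FluidPDE.VectorCalculus.IsDivFree (v t)) →
      (∀ s < 0, ∀ y, ⟪Literature.Analysis.FluidPDE.curl (v s) y, EuclideanSpace.single 2 1⟫_ℝ = 0) →
      v (-1) 0 2 ≠ 0 → (∀ t < 0, ∀ x, Real.sqrt (-t) * |v t x 2| ≤ |v (-1) 0 2|) →
      (∀ h : EuclideanSpace ℝ (Fin 3), fderiv ℝ (v (-1)) 0 h 2 = 0) →
      (deriv (fun s => v s 0 2) (-1) = v (-1) 0 2 / 2 ∧ v (-1) 0 2 * (Δ (fun y => v (-1) y 2)) 0 ≤ 0) →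
      ∀ W : Set (ℝ × EuclideanSpace ℝ (Fin 3)), IsOpen W → W ⊆ Set.Iio (0 : ℝ) ×ˢ Set.univ →
        (∀ z ∈ W, (Literature.Analysis.FluidPDE.curl (v z.1) z.2 ≠ 0 ∧
            (fderiv ℝ (v z.1) z.2 (EuclideanSpace.single 0 1) 2 ≠ 0 ∨ fderiv ℝ (v z.1) z.2 (EuclideanSpace.single 1 1) 2 ≠ 0) ∧
            (fderiv ℝ (v z.1) z.2 (EuclideanSpace.single 2 1) 0 ≠ 0 ∨ fderiv ℝ (v z.1) z.2 (EuclideanSpace.single 2 1) 1 ≠ 0)) ∧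
          (fderiv ℝ (fun x => fderiv ℝ (v z.1) x (EuclideanSpace.single 2 1) 2) z.2 (EuclideanSpace.single 0 1) *
                fderiv ℝ (v z.1) z.2 (EuclideanSpace.single 1 1) 2 -
              fderiv ℝ (fun x => fderiv ℝ (v z.1) x (EuclideanSpace.single 2 1) 2) z.2 (EuclideanSpace.single 1 1) *
                fderiv ℝ (v z.1) z.2 (EuclideanSpace.single 0 1) 2 ≠ 0)) →
        (∀ m : ℝ → ℝ → ℝ, ∀ W₁ : Set (ℝ × EuclideanSpace ℝ (Fin 3)), W₁ ⊆ W → IsOpen W₁ → W₁.Nonempty →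
            ∃ z ∈ W₁, ∃ b : Fin 3, b ≠ 2 ∧
              fderiv ℝ (v z.1) z.2 (EuclideanSpace.single 2 1) b ≠
                m z.1 (z.2 2) * fderiv ℝ (v z.1) z.2 (EuclideanSpace.single b 1) 2) →
        (∀ r : ℝ, 0 < r → (Metric.ball ((-1 : ℝ), (0 : EuclideanSpace ℝ (Fin 3))) r ∩ W).Nonempty) →
        (∀ (s z₀ σ M : ℝ) (K O : Set (EuclideanSpace ℝ (Fin 3))), s < 0 →
          ((σ = 1 ∨ σ = -1) ∧ IsCompact K ∧ K.Nonempty ∧ (∀ y ∈ K, y 2 = z₀ ∧ σ * v s y 2 = M) ∧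
            IsOpen O ∧ K ⊆ O ∧ (∀ y ∈ O, y 2 = z₀ → σ * v s y 2 ≤ M) ∧
            (∀ y ∈ O, y 2 = z₀ → σ * v s y 2 = M → y ∈ K)) → False) →
        False

/-- **The universal WLOG (PROVED):** HL3′ follows from the gap U3a, the no-pin-loss law U3b for least-pin profiles, the (TH)-germ statement and the cell
LEAST-PIN — given HL3′'s profile `v` (pinned, thick, peakless), the class 𝒫(C) is nonempty, so a least-pin profile `U` exists (`exists_leastPin`), it is thick at
its pin (`thickWindow_of_dense thickDense_holds`, mod THGerm), peakless, least-pin and obeys no-pin-loss: the cell kills it. -/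
theorem hl3_of_leastPin (hAG : AnisotropicGap)
    (hNPL : ∀ (C : ℝ) (v : ℝ → EuclideanSpace ℝ (Fin 3) → EuclideanSpace ℝ (Fin 3)), Pinned C v → Peakless v → LeastPin C v → NoPinLoss C v)
    (hTH : THGerm) (hcell : CellLeastPin) : HL3' := by
  intro C v hrate hcont hmild hdiv hpol hne hext hgrad hpins W hWo hWs hnd hsl hacc hpeak
  have hP : Pinned C v := ⟨hrate, hcont, hmild, hdiv, hpol, hne, hext, hgrad, hpins⟩
  have hK : Peakless v := hpeak
  obtain ⟨U, hPU, hKU, hLU⟩ := exists_leastPin hAG hP hK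
  obtain ⟨W', hW'⟩ := thickWindow_of_dense thickDense_holds hTH hPU
  exact hcell hAG C U W' hPU hW' hKU hLU (hNPL C U hPU hKU hLU)

/-- The same kernel with the hands discharged by their stubs (v1.1: both PROVED BY NAME — no sorry) — the shape the lead will consume. -/
theorem hl3_of_stubs (hTH : THGerm) (hcell : CellLeastPin) : HL3' :=
  hl3_of_leastPin stub_anisotropicGap (stub_noPinLoss stub_anisotropicGap) hTH hcell

/-! ## §10 Compositions to the crux items BY NAME (CONDITIONAL on S0, the wall ⟨27893⟩, U3a, U3b and the cell; no summit, no crux is proved) -/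

/-- **The crux `PoloidalWindowRigidity` (K2, stmt-NavierStokesRegularity-19708) BY NAME ⇐ S0 ∧ ⟨27893⟩ ∧ U3a ∧ U3b ∧ LEAST-PIN**, through the tree's
`…HotLoopsReduction.poloidalWindowRigidity_of_NUGRS_of_growth_of_peakless` (HL3′ = its third argument, VERBATIM).  CONDITIONAL. -/
theorem PoloidalWindowRigidity_of_leastPin (hS0 : S0Statement)
    (hG : Summit.NavierStokesRegularity.NavierStokesRegularity.Theses.LoopPeriodRatchet.FrequencyGrowthExponent)
    (hAG : AnisotropicGap)
    (hNPL : ∀ (C : ℝ) (v : ℝ → EuclideanSpace ℝ (Fin 3) → EuclideanSpace ℝ (Fin 3)), Pinned C v → Peakless v → LeastPin C v → NoPinLoss C v)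
    (hcell : CellLeastPin) :
    Summit.NavierStokesRegularity.NavierStokesRegularity.Theses.PoloidalWindowDoor.PoloidalWindowRigidity :=
  PoloidalWindowDoorPoloidalWindowRigidityHotLoopsReduction.poloidalWindowRigidity_of_NUGRS_of_growth_of_peakless hS0 hG
    (hl3_of_leastPin hAG hNPL (thGerm_of_S0 hS0) hcell)

/-- **The item `LrcModEntire` (stmt-NavierStokesRegularity-20428) BY NAME ⇐ S0 ∧ ⟨27893⟩ ∧ U3a ∧ U3b ∧ LEAST-PIN.**  CONDITIONAL. -/
theorem LrcModEntire_of_leastPin (hS0 : S0Statement)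
    (hG : Summit.NavierStokesRegularity.NavierStokesRegularity.Theses.LoopPeriodRatchet.FrequencyGrowthExponent)
    (hAG : AnisotropicGap)
    (hNPL : ∀ (C : ℝ) (v : ℝ → EuclideanSpace ℝ (Fin 3) → EuclideanSpace ℝ (Fin 3)), Pinned C v → Peakless v → LeastPin C v → NoPinLoss C v)
    (hcell : CellLeastPin) :
    Summit.NavierStokesRegularity.NavierStokesRegularity.Theses.PoloidalWindowDoor.LrcModEntire :=
  PoloidalWindowDoorPoloidalWindowRigidityHotLoopsReduction.lrcModEntire_of_NUGRS_of_growth_of_peakless hS0 hG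
    (hl3_of_leastPin hAG hNPL (thGerm_of_S0 hS0) hcell)

/-- With the two hands discharged by their stubs. -/
theorem PoloidalWindowRigidity_of_stubs (hS0 : S0Statement)
    (hG : Summit.NavierStokesRegularity.NavierStokesRegularity.Theses.LoopPeriodRatchet.FrequencyGrowthExponent) (hcell : CellLeastPin) :
    Summit.NavierStokesRegularity.NavierStokesRegularity.Theses.PoloidalWindowDoor.PoloidalWindowRigidity :=
  PoloidalWindowRigidity_of_leastPin hS0 hG stub_anisotropicGap (stub_noPinLoss stub_anisotropicGap) hcell

theorem LrcModEntire_of_stubs (hS0 : S0Statement)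
    (hG : Summit.NavierStokesRegularity.NavierStokesRegularity.Theses.LoopPeriodRatchet.FrequencyGrowthExponent) (hcell : CellLeastPin) :
    Summit.NavierStokesRegularity.NavierStokesRegularity.Theses.PoloidalWindowDoor.LrcModEntire :=
  LrcModEntire_of_leastPin hS0 hG stub_anisotropicGap (stub_noPinLoss stub_anisotropicGap) hcell

/-! ## §11 LINE 25 — THE TIME-SHIFT LEVER (PROVED): forward time shifts stay in the class and CONTRACT the scale-invariant speed; PAST PIN -/

/-- **Past time shifts preserve the class** (`s₁ ≤ 0`, `V ↦ V(· + s₁)`): joint smoothness by composing with the smooth shift, the Oseen identity by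
`oseenDuhamel_translate`, the Type-I rate because `√(−t) ≤ √(−(t + s₁))`.  (The tree has the four-clause form `…CriticalStretchingAnalytic.timeShift_class`;
this is the `IsTypeIAncientMild` form.) -/
theorem isTypeIAncientMild_timeShift {C : ℝ} {V : ℝ → EuclideanSpace ℝ (Fin 3) → EuclideanSpace ℝ (Fin 3)} (h : IsTypeIAncientMild C V)
    {s₁ : ℝ} (hs₁ : s₁ ≤ 0) : IsTypeIAncientMild C (fun t => V (t + s₁)) := by
  have hC0 : 0 ≤ C := h.nonneg
  refine ⟨?_, fun t ht => h.2.1 (t + s₁) (by linarith), fun s t hst ht x => ?_, fun t ht x => ?_⟩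
  · have hφ : ContDiff ℝ ((⊤ : ℕ∞) : WithTop ℕ∞) (fun p : ℝ × EuclideanSpace ℝ (Fin 3) => (p.1 + s₁, p.2)) := by fun_prop
    have hmaps : Set.MapsTo (fun p : ℝ × EuclideanSpace ℝ (Fin 3) => (p.1 + s₁, p.2)) (Set.Iio (0 : ℝ) ×ˢ Set.univ)
        (Set.Iio (0 : ℝ) ×ˢ Set.univ) := by
      intro p hp
      have h1 : p.1 < 0 := (Set.mem_prod.1 hp).1
      exact Set.mk_mem_prod (show p.1 + s₁ < 0 by linarith) (Set.mem_univ _)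
    exact (h.1.comp hφ.contDiffOn hmaps).congr fun p _ => rfl
  · have hm := h.2.2.1 (s + s₁) (t + s₁) (by linarith) (by linarith) x
    rw [oseenDuhamel_translate 1 s s₁ V V t x]
    simpa only [add_sub_add_right_eq_sub] using hm
  · have hts : t + s₁ < 0 := by linarith
    refine (h.2.2.2 (t + s₁) hts x).trans ?_
    exact div_le_div_of_nonneg_left hC0 (Real.sqrt_pos.2 (neg_pos.2 ht)) (Real.sqrt_le_sqrt (by linarith))

/-- **PAST PIN (PROVED) — the lever of LINE 25.**  If `NoPinLoss C v` holds (U3b: every admissible profile dominated by `|N|` has full pin in the sup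
sense), then every admissible profile realises its full pin IN THE ARBITRARILY FAR PAST: for every `η > 0` and every `T < 0` there is `(s, x)` with `s < T`
and `√(−s)|V₂(s,x)| > |N| − η`.  Proof: the forward time shift `V(· + s₁)` (`s₁ = t₀/2 < 0`, where `V(t₀,x₀) ≠ 0`) is again admissible (class:
`isTypeIAncientMild_timeShift`; poloidal and peakless slice-wise; dominated because `√(−t) ≤ √(−(t+s₁))`; non-zero at `(t₀/2, x₀)`), so U3b gives it a
near-extremal point `(t, x)` with defect `η′`: `|N| − η′ < √(−t)|V₂(t+s₁,x)| ≤ (√(−t)/√(−t−s₁))·|N|`, which forces `−(t+s₁) > |N|(−s₁)/(2η′) ≥ −T` for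
`η′ ≤ |N|(−s₁)/(2(−T))`. -/
theorem pastPin {C : ℝ} {v : ℝ → EuclideanSpace ℝ (Fin 3) → EuclideanSpace ℝ (Fin 3)} (hN : v (-1) 0 2 ≠ 0) (hNPL : NoPinLoss C v)
    {V : ℝ → EuclideanSpace ℝ (Fin 3) → EuclideanSpace ℝ (Fin 3)} (hV : IsTypeIAncientMild C V)
    (hpol : ∀ s < 0, ∀ y, ⟪curl (V s) y, EuclideanSpace.single 2 1⟫_ℝ = 0) (hK : Peakless V)
    (hdom : ∀ t < 0, ∀ x, Real.sqrt (-t) * |V t x 2| ≤ |v (-1) 0 2|) (hnz : ¬ ∀ t < 0, ∀ x, V t x = 0) :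
    ∀ η > 0, ∀ T < 0, ∃ s < T, ∃ x, |v (-1) 0 2| - η < Real.sqrt (-s) * |V s x 2| := by
  intro η hη T hT
  have hm0 : 0 < |v (-1) 0 2| := abs_pos.2 hN
  -- a point where `V` is non-zero, and the shift `s₁ := t₀ / 2`
  push Not at hnz
  obtain ⟨t₀, ht₀, x₀, hx₀⟩ := hnz
  have hs₁0 : t₀ / 2 < 0 := by linarith
  -- the shifted profile `V' t := V (t + t₀/2)` is admissible
  have hV'c : IsTypeIAncientMild C (fun t => V (t + t₀ / 2)) := isTypeIAncientMild_timeShift hV hs₁0.le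
  have hpol' : ∀ s < 0, ∀ y, ⟪curl ((fun t => V (t + t₀ / 2)) s) y, EuclideanSpace.single 2 1⟫_ℝ = 0 :=
    fun s hs y => hpol (s + t₀ / 2) (by linarith) y
  have hK' : Peakless (fun t => V (t + t₀ / 2)) :=
    fun s z₀ σ M K O hs hcfg => hK (s + t₀ / 2) z₀ σ M K O (by linarith) hcfg
  have hdom' : ∀ t < 0, ∀ x, Real.sqrt (-t) * |(fun t => V (t + t₀ / 2)) t x 2| ≤ |v (-1) 0 2| := by
    intro t ht x
    have hts : t + t₀ / 2 < 0 := by linarith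
    have h1 := hdom (t + t₀ / 2) hts x
    have h2 : Real.sqrt (-t) ≤ Real.sqrt (-(t + t₀ / 2)) := Real.sqrt_le_sqrt (by linarith)
    calc Real.sqrt (-t) * |(fun t => V (t + t₀ / 2)) t x 2| = Real.sqrt (-t) * |V (t + t₀ / 2) x 2| := rfl
      _ ≤ Real.sqrt (-(t + t₀ / 2)) * |V (t + t₀ / 2) x 2| := mul_le_mul_of_nonneg_right h2 (abs_nonneg _)
      _ ≤ |v (-1) 0 2| := h1
  have hnz' : ¬ ∀ t < 0, ∀ x, (fun t => V (t + t₀ / 2)) t x = 0 := by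
    intro h0
    have h1 : V (t₀ - t₀ / 2 + t₀ / 2) x₀ = 0 := h0 (t₀ - t₀ / 2) (by linarith) x₀
    rw [sub_add_cancel] at h1
    exact hx₀ h1
  -- the defect `η'`, small enough to push the near-extremal point before time `T`
  have hq : 0 < |v (-1) 0 2| * (-(t₀ / 2)) / (2 * (-T)) := div_pos (mul_pos hm0 (by linarith)) (by linarith)
  set η' : ℝ := min η (min (|v (-1) 0 2| / 2) (|v (-1) 0 2| * (-(t₀ / 2)) / (2 * (-T)))) with hη'
  have hη'0 : 0 < η' := lt_min hη (lt_min (by linarith) hq)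
  have hη'η : η' ≤ η := min_le_left _ _
  have hη'm : η' ≤ |v (-1) 0 2| / 2 := (min_le_right _ _).trans (min_le_left _ _)
  have hη'T : η' ≤ |v (-1) 0 2| * (-(t₀ / 2)) / (2 * (-T)) := (min_le_right _ _).trans (min_le_right _ _)
  obtain ⟨t, ht, x, hx⟩ := hNPL (fun t => V (t + t₀ / 2)) hV'c hpol' hK' hdom' hnz' η' hη'0
  have hx' : |v (-1) 0 2| - η' < Real.sqrt (-t) * |V (t + t₀ / 2) x 2| := hx
  have hts : t + t₀ / 2 < 0 := by linarith
  refine ⟨t + t₀ / 2, ?_, x, ?_⟩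
  · -- the time estimate
    have hd := hdom (t + t₀ / 2) hts x
    have hsq_t : 0 ≤ Real.sqrt (-t) := Real.sqrt_nonneg _
    have hsq_s : 0 < Real.sqrt (-(t + t₀ / 2)) := Real.sqrt_pos.2 (by linarith)
    -- `(|N| - η')·√(-(t+s₁)) < |N|·√(-t)`
    have key : (|v (-1) 0 2| - η') * Real.sqrt (-(t + t₀ / 2)) < |v (-1) 0 2| * Real.sqrt (-t) := by
      have h1 : (|v (-1) 0 2| - η') * Real.sqrt (-(t + t₀ / 2)) <
          Real.sqrt (-t) * |V (t + t₀ / 2) x 2| * Real.sqrt (-(t + t₀ / 2)) :=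
        mul_lt_mul_of_pos_right hx' hsq_s
      have h2 : Real.sqrt (-t) * |V (t + t₀ / 2) x 2| * Real.sqrt (-(t + t₀ / 2)) ≤ Real.sqrt (-t) * |v (-1) 0 2| := by
        rw [mul_assoc, mul_comm (|V (t + t₀ / 2) x 2|)]
        exact mul_le_mul_of_nonneg_left hd hsq_t
      linarith
    have hpos : 0 ≤ (|v (-1) 0 2| - η') * Real.sqrt (-(t + t₀ / 2)) := mul_nonneg (by linarith) hsq_s.le
    have key2 := mul_self_lt_mul_self hpos key
    have e1 : Real.sqrt (-(t + t₀ / 2)) * Real.sqrt (-(t + t₀ / 2)) = -(t + t₀ / 2) := Real.mul_self_sqrt (by linarith)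
    have e2 : Real.sqrt (-t) * Real.sqrt (-t) = -t := Real.mul_self_sqrt (by linarith)
    have key3 : (|v (-1) 0 2| - η') ^ 2 * (-(t + t₀ / 2)) < |v (-1) 0 2| ^ 2 * (-t) := by
      have e3 : (|v (-1) 0 2| - η') * Real.sqrt (-(t + t₀ / 2)) * ((|v (-1) 0 2| - η') * Real.sqrt (-(t + t₀ / 2))) =
          (|v (-1) 0 2| - η') ^ 2 * (Real.sqrt (-(t + t₀ / 2)) * Real.sqrt (-(t + t₀ / 2))) := by ring
      have e4 : |v (-1) 0 2| * Real.sqrt (-t) * (|v (-1) 0 2| * Real.sqrt (-t)) =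
          |v (-1) 0 2| ^ 2 * (Real.sqrt (-t) * Real.sqrt (-t)) := by ring
      rw [e3, e4, e1, e2] at key2
      exact key2
    -- `|N|²(-s₁) < (2|N|η' - η'²)(-(t+s₁)) ≤ 2|N|η'(-(t+s₁))` and `2η'(-T) ≤ |N|(-s₁)`
    have hX : 0 < -(t + t₀ / 2) := by linarith
    have k4 : |v (-1) 0 2| ^ 2 * (-(t₀ / 2)) < 2 * |v (-1) 0 2| * η' * (-(t + t₀ / 2)) := by
      nlinarith [key3, mul_nonneg (sq_nonneg η') hX.le]
    have hT' : η' * (2 * (-T)) ≤ |v (-1) 0 2| * (-(t₀ / 2)) := (le_div_iff₀ (by linarith)).1 hη'T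
    have k5 : 2 * |v (-1) 0 2| * η' * (-T) ≤ |v (-1) 0 2| ^ 2 * (-(t₀ / 2)) := by nlinarith [hT', hm0]
    have k6 : 2 * |v (-1) 0 2| * η' * (-T) < 2 * |v (-1) 0 2| * η' * (-(t + t₀ / 2)) := lt_of_le_of_lt k5 k4
    have hmη : 0 < 2 * |v (-1) 0 2| * η' := mul_pos (mul_pos two_pos hm0) hη'0
    have k7 : -T < -(t + t₀ / 2) := lt_of_mul_lt_mul_left k6 hmη.le
    linarith
  · have h2 : Real.sqrt (-t) ≤ Real.sqrt (-(t + t₀ / 2)) := Real.sqrt_le_sqrt (by linarith)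
    calc |v (-1) 0 2| - η ≤ |v (-1) 0 2| - η' := by linarith
      _ < Real.sqrt (-t) * |V (t + t₀ / 2) x 2| := hx'
      _ ≤ Real.sqrt (-(t + t₀ / 2)) * |V (t + t₀ / 2) x 2| := mul_le_mul_of_nonneg_right h2 (abs_nonneg _)

/-- **PAST PIN for the profile itself**: a pinned peakless profile obeying NO-PIN-LOSS is near-extremal at times `s → −∞` — the pin time `−1` is not the
last, nor the first, near-pin. -/
theorem pastPin_self {C : ℝ} {v : ℝ → EuclideanSpace ℝ (Fin 3) → EuclideanSpace ℝ (Fin 3)} (hP : Pinned C v) (hK : Peakless v) (hNPL : NoPinLoss C v) :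
    ∀ η > 0, ∀ T < 0, ∃ s < T, ∃ x, |v (-1) 0 2| - η < Real.sqrt (-s) * |v s x 2| :=
  pastPin hP.2.2.2.2.2.1 hNPL (class_of_pinned hP) hP.2.2.2.2.1 hK hP.2.2.2.2.2.2.1 (fun hz => pinned_absurd_of_zero hP hz)

/-! ## §12 ETERNAL PIN IN SCALE WINDOWS (PROVED from U3b + U2b + compactness): every far-past scale window of bounded log-length and bounded aperture
carries a near-pin -/

/-- **EternalCore ε₀ R₀ T₀ U** — VERBATIM LINE 23 `eternal_core`: every backward scale window `[4t₀, t₀]`, `t₀ < T₀`, carries a point of the paraboloid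
`‖y‖ ≤ R₀√(−r)` where the scale-covariant speed is at least `ε₀`. -/
def EternalCore (ε₀ R₀ T₀ : ℝ) (U : ℝ → EuclideanSpace ℝ (Fin 3) → EuclideanSpace ℝ (Fin 3)) : Prop :=
  ∀ t₀ : ℝ, t₀ < T₀ → ∃ r ∈ Set.Icc (4 * t₀) t₀, ∃ y : EuclideanSpace ℝ (Fin 3),
    ‖y‖ ≤ R₀ * Real.sqrt (-r) ∧ ε₀ ≤ Real.sqrt (-r) * ‖U r y‖

/-- **U2b `ParaboloidGap`** — VERBATIM LINE 23 `eternal_core` (LANDED: p707892 `…EternalCoreParaboloidGap.paraboloidGap`, ns-es-p1 g8). -/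
def ParaboloidGap : Prop :=
  ∀ C : ℝ, ∃ ε₁ : ℝ, 0 < ε₁ ∧ ∀ ε : ℝ, 0 < ε → ε ≤ ε₁ → ∃ R₁ : ℝ, 0 < R₁ ∧ ∀ R : ℝ, R₁ ≤ R →
    ∀ (U : ℝ → EuclideanSpace ℝ (Fin 3) → EuclideanSpace ℝ (Fin 3)), IsTypeIAncientMild C U → ∀ t₀ : ℝ, t₀ < 0 →
      (∀ r ∈ Set.Icc (4 * t₀) t₀, ∀ y : EuclideanSpace ℝ (Fin 3), ‖y‖ ≤ R * Real.sqrt (-r) → Real.sqrt (-r) * ‖U r y‖ ≤ ε) →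
      ∀ s : ℝ, t₀ ≤ s → s < 0 → ∀ x : EuclideanSpace ℝ (Fin 3), ‖x‖ ≤ R / 4 * Real.sqrt (-s) →
        Real.sqrt (-s) * ‖U s x‖ ≤ 2 * ε

/-- U2b BY NAME (LANDED p707892). -/
theorem paraboloidGap : ParaboloidGap :=
  Summit.NavierStokesRegularity.NavierStokesRegularity.Theorems.PoloidalWindowDoorPoloidalWindowRigidityEternalCoreParaboloidGap.paraboloidGap

/-- `|N| ≤ ‖U(−1,0)‖` — VERBATIM LINE 23. -/
theorem absN_le_norm (U : ℝ → EuclideanSpace ℝ (Fin 3) → EuclideanSpace ℝ (Fin 3)) : |U (-1) 0 2| ≤ ‖U (-1) 0‖ := by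
  have h := EuclideanSpace.norm_eq (U (-1) 0)
  have h2 : |U (-1) 0 2| ^ 2 ≤ ∑ i, |U (-1) 0 i| ^ 2 :=
    Finset.single_le_sum (f := fun i => |U (-1) 0 i| ^ 2) (fun i _ => by positivity) (Finset.mem_univ (2 : Fin 3))
  rw [h]
  have h4 : Real.sqrt (|U (-1) 0 2| ^ 2) = |U (-1) 0 2| := Real.sqrt_sq (abs_nonneg _)
  calc |U (-1) 0 2| = Real.sqrt (|U (-1) 0 2| ^ 2) := h4.symm
    _ ≤ Real.sqrt (∑ i, |U (-1) 0 i| ^ 2) := Real.sqrt_le_sqrt h2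
    _ = Real.sqrt (∑ i, ‖U (-1) 0 i‖ ^ 2) := by simp [Real.norm_eq_abs]

/-- **The pin refuses a small parabolic window** — VERBATIM LINE 23 (PROVED from U2b). -/
theorem notSmallWindow_of_pinned (hG : ParaboloidGap) {C : ℝ} {U : ℝ → EuclideanSpace ℝ (Fin 3) → EuclideanSpace ℝ (Fin 3)} (hP : Pinned C U) :
    ∃ ε₀ : ℝ, 0 < ε₀ ∧ ∃ R₀ : ℝ, 0 < R₀ ∧ ∀ t₀ : ℝ, t₀ ≤ -1 →
      ¬ (∀ r ∈ Set.Icc (4 * t₀) t₀, ∀ y : EuclideanSpace ℝ (Fin 3), ‖y‖ ≤ R₀ * Real.sqrt (-r) → Real.sqrt (-r) * ‖U r y‖ ≤ ε₀) := by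
  obtain ⟨ε₁, hε₁, hg⟩ := hG C
  have hN : U (-1) 0 2 ≠ 0 := hP.2.2.2.2.2.1
  have ha : 0 < |U (-1) 0 2| := abs_pos.2 hN
  set ε : ℝ := min ε₁ (|U (-1) 0 2| / 4) with hεdef
  have hε : 0 < ε := lt_min hε₁ (by positivity)
  have hεle : ε ≤ ε₁ := min_le_left _ _
  have hεa : ε ≤ |U (-1) 0 2| / 4 := min_le_right _ _
  obtain ⟨R₁, hR₁, hR⟩ := hg ε hε hεle
  refine ⟨ε, hε, R₁, hR₁, fun t₀ ht₀ hsmall => ?_⟩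
  have ht₀' : t₀ < 0 := by linarith
  have h := hR R₁ le_rfl U (class_of_pinned hP) t₀ ht₀' hsmall (-1) ht₀ (by norm_num) 0
    (by rw [norm_zero]; positivity)
  have h1 : Real.sqrt (-(-1 : ℝ)) = 1 := by norm_num
  rw [h1, one_mul] at h
  have h2 := absN_le_norm U
  linarith

/-- **U2 `eternalCore_of_pinned`** — VERBATIM LINE 23 (PROVED from U2b): a pinned profile has an ETERNAL CORE. -/
theorem eternalCore_of_pinned (hG : ParaboloidGap) {C : ℝ} {U : ℝ → EuclideanSpace ℝ (Fin 3) → EuclideanSpace ℝ (Fin 3)} (hP : Pinned C U) :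
    ∃ ε₀ : ℝ, 0 < ε₀ ∧ ∃ R₀ : ℝ, 0 < R₀ ∧ EternalCore ε₀ R₀ (-1) U := by
  obtain ⟨ε₀, hε₀, R₀, hR₀, hwin⟩ := notSmallWindow_of_pinned hG hP
  refine ⟨ε₀, hε₀, R₀, hR₀, fun t₀ ht₀ => ?_⟩
  by_contra hcon
  push Not at hcon
  exact hwin t₀ ht₀.le fun r hr y hy => (hcon r hr y hy).le

/-- **ScaleWindowPin v** — ETERNAL PIN IN SCALE WINDOWS (critic W1's «eternal pin», sup sense, located): for every defect `η > 0` there is `Λ ≥ 1` such that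
EVERY backward scale window `[Λt₀, t₀]` (`t₀ ≤ −1`) contains a point of bounded aperture `‖x‖ ≤ Λ√(−t)` where the scale-invariant vertical speed exceeds
`|N| − η`. -/
def ScaleWindowPin (v : ℝ → EuclideanSpace ℝ (Fin 3) → EuclideanSpace ℝ (Fin 3)) : Prop :=
  ∀ η : ℝ, 0 < η → ∃ Λ : ℝ, 1 ≤ Λ ∧ ∀ t₀ : ℝ, t₀ ≤ -1 →
    ∃ t ∈ Set.Icc (Λ * t₀) t₀, ∃ x : EuclideanSpace ℝ (Fin 3),
      ‖x‖ ≤ Λ * Real.sqrt (-t) ∧ |v (-1) 0 2| - η < Real.sqrt (-t) * |v t x 2|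

/-- **ETERNAL PIN IN SCALE WINDOWS (PROVED from U3b, U2b and compactness).**  See the module docstring: failing windows with `Λₙ = n + 1` are rescaled to end at
`−1`; a KNSS limit of the rescaled profiles is admissible and non-zero (eternal core, scale-covariant, passes to the limit by K2-p2 g14's
`eternalCore_of_limit`) and `η`-pin-free on `{t ≤ −1}`, contradicting PAST PIN with `T = −1`. -/
theorem scaleWindowPin_of_noPinLoss {C : ℝ} {v : ℝ → EuclideanSpace ℝ (Fin 3) → EuclideanSpace ℝ (Fin 3)} (hP : Pinned C v) (hK : Peakless v)
    (hNPL : NoPinLoss C v) : ScaleWindowPin v := by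
  intro η hη
  by_contra hcon
  push Not at hcon
  have hN : v (-1) 0 2 ≠ 0 := hP.2.2.2.2.2.1
  have hcl : IsTypeIAncientMild C v := class_of_pinned hP
  -- failing windows with `Λ = n + 1`
  have hΛ : ∀ n : ℕ, (1 : ℝ) ≤ (n : ℝ) + 1 := fun n => by have := n.cast_nonneg (α := ℝ); linarith
  choose t₀ ht₀ hfree using fun n : ℕ => hcon ((n : ℝ) + 1) (hΛ n)
  -- rescale the window top to `−1`: `c n := √(−t₀ n) ≥ 1`, `vs n := nsRescale (c n) v`
  have hc0 : ∀ n, 0 < Real.sqrt (-t₀ n) := fun n => Real.sqrt_pos.2 (by linarith [ht₀ n])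
  have hc1 : ∀ n, 1 ≤ Real.sqrt (-t₀ n) := fun n => by
    rw [show (1 : ℝ) = Real.sqrt 1 from Real.sqrt_one.symm]
    exact Real.sqrt_le_sqrt (by linarith [ht₀ n])
  have hcsq : ∀ n, Real.sqrt (-t₀ n) ^ 2 = -t₀ n := fun n => Real.sq_sqrt (by linarith [ht₀ n])
  set vs : ℕ → ℝ → EuclideanSpace ℝ (Fin 3) → EuclideanSpace ℝ (Fin 3) := fun n => nsRescale (Real.sqrt (-t₀ n)) v with hvs
  have hw : ∀ n, IsTypeIAncientMild C (vs n) := fun n => hcl.nsRescale (hc0 n)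
  -- the rescaled profiles are `η`-pin-free on `t ∈ [−(n+1), −1]`, `‖x‖ ≤ (n+1)√(−t)`
  have hfree' : ∀ n : ℕ, ∀ t : ℝ, -((n : ℝ) + 1) ≤ t → t ≤ -1 → ∀ x : EuclideanSpace ℝ (Fin 3), ‖x‖ ≤ ((n : ℝ) + 1) * Real.sqrt (-t) →
      Real.sqrt (-t) * |vs n t x 2| ≤ |v (-1) 0 2| - η := by
    intro n t ht1 ht2 x hx
    have hmem : Real.sqrt (-t₀ n) ^ 2 * t ∈ Set.Icc (((n : ℝ) + 1) * t₀ n) (t₀ n) := by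
      rw [hcsq, Set.mem_Icc]
      have h1 : 0 ≤ (t + ((n : ℝ) + 1)) * (-t₀ n) := mul_nonneg (by linarith) (by linarith [ht₀ n])
      have h2 : 0 ≤ (-1 - t) * (-t₀ n) := mul_nonneg (by linarith) (by linarith [ht₀ n])
      constructor <;> nlinarith [h1, h2]
    have hxs : ‖Real.sqrt (-t₀ n) • x‖ ≤ ((n : ℝ) + 1) * Real.sqrt (-(Real.sqrt (-t₀ n) ^ 2 * t)) := by
      rw [PoloidalWindowDoorPoloidalWindowRigidityEternalCoreScalingCore.sqrt_neg_sq_mul (hc0 n).le, norm_smul, Real.norm_eq_abs,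
        abs_of_pos (hc0 n)]
      calc Real.sqrt (-t₀ n) * ‖x‖ ≤ Real.sqrt (-t₀ n) * (((n : ℝ) + 1) * Real.sqrt (-t)) := mul_le_mul_of_nonneg_left hx (hc0 n).le
        _ = ((n : ℝ) + 1) * (Real.sqrt (-t₀ n) * Real.sqrt (-t)) := by ring
    have key := hfree n (Real.sqrt (-t₀ n) ^ 2 * t) hmem (Real.sqrt (-t₀ n) • x) hxs
    rw [PoloidalWindowDoorPoloidalWindowRigidityEternalCoreScalingCore.sqrt_neg_sq_mul (hc0 n).le] at key
    have e : Real.sqrt (-t) * |vs n t x 2| = Real.sqrt (-t₀ n) * Real.sqrt (-t) * |v (Real.sqrt (-t₀ n) ^ 2 * t) (Real.sqrt (-t₀ n) • x) 2| := by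
      simp only [hvs, nsRescale_apply, PiLp.smul_apply, smul_eq_mul, abs_mul, abs_of_pos (hc0 n)]
      ring
    rw [e]
    exact key
  -- a KNSS limit of the rescaled profiles
  obtain ⟨φ, hφ, V, hV, hpt, hfd, htlu, -⟩ := exists_tendsto_of_isTypeIAncientMild_seq C hw
  have hpolv : ∀ s < 0, ∀ y, ⟪curl (v s) y, EuclideanSpace.single 2 1⟫_ℝ = 0 := hP.2.2.2.2.1
  have hpolV : ∀ s < 0, ∀ y, ⟪curl (V s) y, EuclideanSpace.single 2 1⟫_ℝ = 0 :=
    fun s hs y => PoloidalWindowDoorPoloidalWindowRigidityPoloidalExtremal.poloidal_of_tendsto (hfd s hs y)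
      (fun j => PoloidalWindowDoorPoloidalWindowRigidityPoloidalExtremal.poloidal_nsRescale hpolv (hc0 (φ j)) s hs y)
  have hKV : Peakless V :=
    PoloidalWindowDoorPoloidalWindowRigidityHotHullCompactness.peaklessClosed (fun j => vs (φ j)) V
      (fun j => PoloidalWindowDoorPoloidalWindowRigidityLeastPinNoPinLoss.peakless_nsRescale hK (hc0 (φ j)))
      (fun j t ht => ((hw (φ j)).contDiff_slice ht).continuous) (fun t ht => (hV.contDiff_slice ht).continuous) (fun t ht => htlu t ht)
  have hc2 : Continuous fun x : EuclideanSpace ℝ (Fin 3) => x 2 := by fun_prop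
  have hval : ∀ t < 0, ∀ x, Tendsto (fun j => vs (φ j) t x 2) atTop (𝓝 (V t x 2)) :=
    fun t ht x => (hc2.tendsto _).comp (hpt t ht x)
  have hdomV : ∀ t < 0, ∀ x, Real.sqrt (-t) * |V t x 2| ≤ |v (-1) 0 2| := fun t ht x =>
    le_of_tendsto (((continuous_const.mul continuous_abs).tendsto _).comp (hval t ht x))
      (Eventually.of_forall fun j =>
        PoloidalWindowDoorPoloidalWindowRigidityEternalCoreScalingCore.extremal_nsRescale hP.2.2.2.2.2.2.1 (hc0 (φ j)) t ht x)
  -- the limit is NON-ZERO: the eternal core is scale-covariant and passes to the limit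
  obtain ⟨ε₀, hε₀, R₀, hR₀, hcore⟩ := eternalCore_of_pinned paraboloidGap hP
  have hcoreV := PoloidalWindowDoorPoloidalWindowRigidityEternalCoreScalingCore.eternalCore_of_limit C ε₀ R₀ (-1) (by norm_num)
    (fun j => hw (φ j)) hV hpt
    (fun t₁ ht₁ => Eventually.of_forall fun j =>
      PoloidalWindowDoorPoloidalWindowRigidityEternalCoreScalingCore.eternalCore_nsRescale hcore (hc0 (φ j)) t₁
        (by
          have h1 : 0 ≤ (Real.sqrt (-t₀ (φ j)) ^ 2 - 1) * (-1 - t₁) :=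
            mul_nonneg (by nlinarith [hc1 (φ j)]) (by linarith)
          nlinarith [h1, hc1 (φ j)]))
  have hnzV : ¬ ∀ t < 0, ∀ x, V t x = 0 := by
    intro h0
    obtain ⟨r, hr, y, -, hε⟩ := hcoreV (-2) (by norm_num)
    have hr0 : r < 0 := by linarith [hr.2]
    rw [h0 r hr0 y, norm_zero, mul_zero] at hε
    linarith
  -- the limit is `η`-pin-free on `{t ≤ −1}`
  have hfreeV : ∀ t : ℝ, t ≤ -1 → ∀ x : EuclideanSpace ℝ (Fin 3), Real.sqrt (-t) * |V t x 2| ≤ |v (-1) 0 2| - η := by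
    intro t ht x
    have ht0 : t < 0 := by linarith
    have hsq0 : 0 < Real.sqrt (-t) := Real.sqrt_pos.2 (by linarith)
    refine le_of_tendsto (((continuous_const.mul continuous_abs).tendsto _).comp (hval t ht0 x)) ?_
    obtain ⟨N₀, hN₀⟩ := exists_nat_ge (max (-t) (‖x‖ / Real.sqrt (-t)))
    refine eventually_atTop.2 ⟨N₀, fun j hj => ?_⟩
    have hφj : (N₀ : ℝ) ≤ (φ j : ℝ) := by exact_mod_cast hj.trans (hφ.id_le j)
    refine hfree' (φ j) t ?_ ht x ?_
    · linarith [le_max_left (-t) (‖x‖ / Real.sqrt (-t))]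
    · have h1 : ‖x‖ / Real.sqrt (-t) ≤ (φ j : ℝ) + 1 := by linarith [le_max_right (-t) (‖x‖ / Real.sqrt (-t))]
      rwa [div_le_iff₀ hsq0] at h1
  -- PAST PIN for the limit with `T = −1` is the contradiction
  obtain ⟨s, hs, x, hx⟩ := pastPin hN hNPL hV hpolV hKV hdomV hnzV η hη (-1) (by norm_num)
  have := hfreeV s hs.le x
  linarith

/-- **NEAR-PINNED BLOW-DOWNS (PROVED; census B-g8-3 inverted up to `η`).**  In blow-down language: for every `η > 0` there is `Λ ≥ 1` such that every scale
window `[Λt₀, t₀]`, `t₀ ≤ −1`, contains a time `t` whose blow-down `nsRescale √(−t) v` (the profile seen at scale `√(−t)` from the blow-up point) carries an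
`η`-near-pin AT TIME `−1` INSIDE THE BALL `‖y‖ ≤ Λ`. -/
theorem nearPinnedBlowDowns {C : ℝ} {v : ℝ → EuclideanSpace ℝ (Fin 3) → EuclideanSpace ℝ (Fin 3)} (hP : Pinned C v) (hK : Peakless v)
    (hNPL : NoPinLoss C v) :
    ∀ η : ℝ, 0 < η → ∃ Λ : ℝ, 1 ≤ Λ ∧ ∀ t₀ : ℝ, t₀ ≤ -1 → ∃ t ∈ Set.Icc (Λ * t₀) t₀, ∃ y : EuclideanSpace ℝ (Fin 3),
      ‖y‖ ≤ Λ ∧ |v (-1) 0 2| - η < |nsRescale (Real.sqrt (-t)) v (-1) y 2| := by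
  intro η hη
  obtain ⟨Λ, hΛ, hwin⟩ := scaleWindowPin_of_noPinLoss hP hK hNPL η hη
  refine ⟨Λ, hΛ, fun t₀ ht₀ => ?_⟩
  obtain ⟨t, ht, x, hx, hpin⟩ := hwin t₀ ht₀
  have ht1 : t ≤ -1 := ht.2.trans ht₀
  have hc : 0 < Real.sqrt (-t) := Real.sqrt_pos.2 (by linarith)
  refine ⟨t, ht, (Real.sqrt (-t))⁻¹ • x, ?_, ?_⟩
  · rw [norm_smul, norm_inv, Real.norm_eq_abs, abs_of_pos hc, inv_mul_le_iff₀ hc, mul_comm]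
    exact hx
  · have h2 : Real.sqrt (-t) ^ 2 * (-1) = t := by rw [Real.sq_sqrt (by linarith)]; ring
    have h3 : Real.sqrt (-t) • ((Real.sqrt (-t))⁻¹ • x) = x := by rw [smul_smul, mul_inv_cancel₀ hc.ne', one_smul]
    rw [nsRescale_apply, h3, h2, PiLp.smul_apply, smul_eq_mul, abs_mul, abs_of_pos hc]
    exact hpin

/-- **NEAR-PINNED BLOW-DOWN LIMITS EXIST (PROVED).**  For every `η > 0` the blow-down hull of a least-pin profile obeying NO-PIN-LOSS contains an ADMISSIBLE profile
`V` (class `C`, e₂-poloidal, peakless, dominated by `|N|`) — a slice-wise limit of blow-downs `nsRescale cⱼ v`, `cⱼ → ∞` — with an `η`-near-pin AT TIME `−1` inside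
the ball `‖y‖ ≤ Λ(η)`: the object on which the scaling dynamics of the column (LINE 23 U2d, hot_hull RECURRENT-LEAF) acts. -/
theorem nearPinnedBlowDownLimit {C : ℝ} {v : ℝ → EuclideanSpace ℝ (Fin 3) → EuclideanSpace ℝ (Fin 3)} (hP : Pinned C v) (hK : Peakless v)
    (hNPL : NoPinLoss C v) :
    ∀ η : ℝ, 0 < η → ∃ Λ : ℝ, 1 ≤ Λ ∧ ∃ V : ℝ → EuclideanSpace ℝ (Fin 3) → EuclideanSpace ℝ (Fin 3),
      IsTypeIAncientMild C V ∧ (∀ s < 0, ∀ y, ⟪curl (V s) y, EuclideanSpace.single 2 1⟫_ℝ = 0) ∧ Peakless V ∧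
      (∀ t < 0, ∀ x, Real.sqrt (-t) * |V t x 2| ≤ |v (-1) 0 2|) ∧
      (∃ y : EuclideanSpace ℝ (Fin 3), ‖y‖ ≤ Λ ∧ |v (-1) 0 2| - η ≤ |V (-1) y 2|) ∧
      ∃ c : ℕ → ℝ, (∀ j, 1 ≤ c j) ∧ Tendsto c atTop atTop ∧ ∀ t < 0, ∀ x, Tendsto (fun j => nsRescale (c j) v t x) atTop (𝓝 (V t x)) := by
  intro η hη
  obtain ⟨Λ, hΛ, hwin⟩ := nearPinnedBlowDowns hP hK hNPL η hη
  refine ⟨Λ, hΛ, ?_⟩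
  have hcl : IsTypeIAncientMild C v := class_of_pinned hP
  choose t ht y hy hpin using fun n : ℕ => hwin (-((n : ℝ) + 1)) (by linarith [n.cast_nonneg (α := ℝ)])
  -- Bolzano–Weierstrass for the near-pin positions
  obtain ⟨yb, hybmem, ψ, hψ, hyψ⟩ := tendsto_subseq_of_bounded (Metric.isBounded_closedBall (x := (0 : EuclideanSpace ℝ (Fin 3))) (r := Λ))
    (x := y) (fun n => mem_closedBall_zero_iff.2 (hy n))
  have hybnorm : ‖yb‖ ≤ Λ := by
    rw [Metric.isClosed_closedBall.closure_eq] at hybmem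
    exact mem_closedBall_zero_iff.1 hybmem
  -- the blow-downs at the window times
  have ht1 : ∀ n, t (ψ n) ≤ -1 := fun n => (ht (ψ n)).2.trans (by linarith [(ψ n).cast_nonneg (α := ℝ)])
  have htn : ∀ n : ℕ, (n : ℝ) + 1 ≤ -t (ψ n) := fun n => by
    have h1 := (ht (ψ n)).2
    have h2 : (n : ℝ) ≤ (ψ n : ℝ) := by exact_mod_cast hψ.id_le n
    linarith
  set c : ℕ → ℝ := fun n => Real.sqrt (-t (ψ n)) with hc
  have hc0 : ∀ n, 0 < c n := fun n => Real.sqrt_pos.2 (by linarith [ht1 n])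
  have hc1 : ∀ n, 1 ≤ c n := fun n => by
    rw [show (1 : ℝ) = Real.sqrt 1 from Real.sqrt_one.symm]
    exact Real.sqrt_le_sqrt (by linarith [ht1 n])
  have hcTop : Tendsto c atTop atTop := by
    have h1 : Tendsto (fun n : ℕ => Real.sqrt ((n : ℝ) + 1)) atTop atTop :=
      Real.tendsto_sqrt_atTop.comp (tendsto_atTop_add_const_right _ 1 tendsto_natCast_atTop_atTop)
    exact tendsto_atTop_mono (fun n => Real.sqrt_le_sqrt (htn n)) h1
  set w : ℕ → ℝ → EuclideanSpace ℝ (Fin 3) → EuclideanSpace ℝ (Fin 3) := fun n => nsRescale (c n) v with hw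
  have hwc : ∀ n, IsTypeIAncientMild C (w n) := fun n => hcl.nsRescale (hc0 n)
  obtain ⟨φ, hφ, V, hV, hpt, hfd, htlu, -⟩ := exists_tendsto_of_isTypeIAncientMild_seq C hwc
  have hpolv : ∀ s < 0, ∀ y, ⟪curl (v s) y, EuclideanSpace.single 2 1⟫_ℝ = 0 := hP.2.2.2.2.1
  have hpolV : ∀ s < 0, ∀ y, ⟪curl (V s) y, EuclideanSpace.single 2 1⟫_ℝ = 0 :=
    fun s hs y => PoloidalWindowDoorPoloidalWindowRigidityPoloidalExtremal.poloidal_of_tendsto (hfd s hs y)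
      (fun j => PoloidalWindowDoorPoloidalWindowRigidityPoloidalExtremal.poloidal_nsRescale hpolv (hc0 (φ j)) s hs y)
  have hKV : Peakless V :=
    PoloidalWindowDoorPoloidalWindowRigidityHotHullCompactness.peaklessClosed (fun j => w (φ j)) V
      (fun j => PoloidalWindowDoorPoloidalWindowRigidityLeastPinNoPinLoss.peakless_nsRescale hK (hc0 (φ j)))
      (fun j t ht => ((hwc (φ j)).contDiff_slice ht).continuous) (fun t ht => (hV.contDiff_slice ht).continuous) (fun t ht => htlu t ht)
  have hc2 : Continuous fun x : EuclideanSpace ℝ (Fin 3) => x 2 := by fun_prop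
  have hdomV : ∀ t < 0, ∀ x, Real.sqrt (-t) * |V t x 2| ≤ |v (-1) 0 2| := fun t ht x =>
    le_of_tendsto (((continuous_const.mul continuous_abs).tendsto _).comp ((hc2.tendsto _).comp (hpt t ht x)))
      (Eventually.of_forall fun j =>
        PoloidalWindowDoorPoloidalWindowRigidityEternalCoreScalingCore.extremal_nsRescale hP.2.2.2.2.2.2.1 (hc0 (φ j)) t ht x)
  -- the near-pin passes to the limit along the moving points `y (ψ (φ j)) → yb`
  have hg : Tendsto (fun j => y (ψ (φ j))) atTop (𝓝 yb) := hyψ.comp hφ.tendsto_atTop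
  have hcontV : ContinuousAt (V (-1)) yb := ((hV.contDiff_slice (by norm_num)).continuous).continuousAt
  have hlim : Tendsto (fun j => w (φ j) (-1) (y (ψ (φ j)))) atTop (𝓝 (V (-1) yb)) := (htlu (-1) (by norm_num)).tendsto_comp hcontV hg
  have hlim2 : Tendsto (fun j => |w (φ j) (-1) (y (ψ (φ j))) 2|) atTop (𝓝 |V (-1) yb 2|) :=
    (continuous_abs.tendsto _).comp ((hc2.tendsto _).comp hlim)
  have hpinV : |v (-1) 0 2| - η ≤ |V (-1) yb 2| :=
    ge_of_tendsto hlim2 (Eventually.of_forall fun j => (hpin (ψ (φ j))).le)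
  exact ⟨V, hV, hpolV, hKV, hdomV, ⟨yb, hybnorm, hpinV⟩, fun j => c (φ j), fun j => hc1 (φ j), hcTop.comp hφ.tendsto_atTop,
    fun t ht x => hpt t ht x⟩

/-! ## §13 The research cell ETERNAL-PIN (OPEN): LEAST-PIN's binders + PAST PIN (as a law over the admissible class) + ETERNAL PIN IN SCALE WINDOWS -/

/-- **PastPin C v** — the PAST-PIN LAW (PROVED in §11 from `NoPinLoss C v`) as a predicate: every admissible profile dominated by `|N|` is near-extremal in the
arbitrarily far past. -/
def PastPin (C : ℝ) (v : ℝ → EuclideanSpace ℝ (Fin 3) → EuclideanSpace ℝ (Fin 3)) : Prop :=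
  ∀ V : ℝ → EuclideanSpace ℝ (Fin 3) → EuclideanSpace ℝ (Fin 3), IsTypeIAncientMild C V →
    (∀ s < 0, ∀ y, ⟪curl (V s) y, EuclideanSpace.single 2 1⟫_ℝ = 0) → Peakless V →
    (∀ t < 0, ∀ x, Real.sqrt (-t) * |V t x 2| ≤ |v (-1) 0 2|) → (¬ ∀ t < 0, ∀ x, V t x = 0) →
    ∀ η > 0, ∀ T < 0, ∃ s < T, ∃ x, |v (-1) 0 2| - η < Real.sqrt (-s) * |V s x 2|

/-- **Research cell ETERNAL-PIN (OPEN).**  Kill a pinned, thick, peakless class-`C` LEAST-PIN profile obeying NO-PIN-LOSS, the PAST-PIN LAW over its admissible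
class, and ETERNALLY PINNED IN SCALE WINDOWS with bounded aperture.  (All binders after `LeastPin` are THEOREMS for least-pin profiles — the kernel below derives
them; the cell states them so that the research prover has them as data.) -/
def CellEternalPin : Prop :=
  AnisotropicGap →
  ∀ (C : ℝ) (v : ℝ → EuclideanSpace ℝ (Fin 3) → EuclideanSpace ℝ (Fin 3)) (W : Set (ℝ × EuclideanSpace ℝ (Fin 3))),
    Pinned C v → ThickWindow v W → Peakless v → LeastPin C v → NoPinLoss C v → PastPin C v → ScaleWindowPin v → False

/-- **stub ETERNAL-PIN** (research, OPEN) — the only `sorry` of the file. -/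
theorem stub_cellEternalPin : CellEternalPin := by
  sorry

/-- **Kernel (PROVED): cell ETERNAL-PIN ⇒ cell LEAST-PIN** — the two extra binders are theorems (`pastPin`, `scaleWindowPin_of_noPinLoss`). -/
theorem cellLeastPin_of_eternalPin (hcell : CellEternalPin) : CellLeastPin := by
  intro hAG C v W hP hW hK hL hNPL
  exact hcell hAG C v W hP hW hK hL hNPL
    (fun V hV hpol hKV hdom hnz => pastPin hP.2.2.2.2.2.1 hNPL hV hpol hKV hdom hnz)
    (scaleWindowPin_of_noPinLoss hP hK hNPL)

/-- **HL3′ ⇐ THGerm ∧ ETERNAL-PIN** (U3a, U3b discharged BY NAME). -/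
theorem hl3_of_eternalPin (hTH : THGerm) (hcell : CellEternalPin) : HL3' :=
  hl3_of_stubs hTH (cellLeastPin_of_eternalPin hcell)

/-! ## §14 Compositions to the crux items BY NAME (CONDITIONAL on S0, the wall ⟨27893⟩ and the cell ETERNAL-PIN; no summit, no crux is proved) -/

/-- **The crux `PoloidalWindowRigidity` (K2, stmt-NavierStokesRegularity-19708) BY NAME ⇐ S0 ∧ ⟨27893⟩ ∧ ETERNAL-PIN.**  CONDITIONAL. -/
theorem PoloidalWindowRigidity_of_eternalPin (hS0 : S0Statement)
    (hG : Summit.NavierStokesRegularity.NavierStokesRegularity.Theses.LoopPeriodRatchet.FrequencyGrowthExponent) (hcell : CellEternalPin) :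
    Summit.NavierStokesRegularity.NavierStokesRegularity.Theses.PoloidalWindowDoor.PoloidalWindowRigidity :=
  PoloidalWindowRigidity_of_stubs hS0 hG (cellLeastPin_of_eternalPin hcell)

/-- **The item `LrcModEntire` (stmt-NavierStokesRegularity-20428) BY NAME ⇐ S0 ∧ ⟨27893⟩ ∧ ETERNAL-PIN.**  CONDITIONAL. -/
theorem LrcModEntire_of_eternalPin (hS0 : S0Statement)
    (hG : Summit.NavierStokesRegularity.NavierStokesRegularity.Theses.LoopPeriodRatchet.FrequencyGrowthExponent) (hcell : CellEternalPin) :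
    Summit.NavierStokesRegularity.NavierStokesRegularity.Theses.PoloidalWindowDoor.LrcModEntire :=
  LrcModEntire_of_stubs hS0 hG (cellLeastPin_of_eternalPin hcell)

/-- With the research cell taken from its stub — the shape the lead consumes (sorry: the cell only). -/
theorem PoloidalWindowRigidity_of_cellStub (hS0 : S0Statement)
    (hG : Summit.NavierStokesRegularity.NavierStokesRegularity.Theses.LoopPeriodRatchet.FrequencyGrowthExponent) :
    Summit.NavierStokesRegularity.NavierStokesRegularity.Theses.PoloidalWindowDoor.PoloidalWindowRigidity :=
  PoloidalWindowRigidity_of_eternalPin hS0 hG stub_cellEternalPin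

end Summit.NavierStokesRegularity.NavierStokesRegularity.Cruxes.PoloidalWindowRigidity.EternalPin
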